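import Literature.NumberTheory.EllipticCurves.ThreeTorsionFakePointSwanProofs
import Literature.NumberTheory.GaloisRepresentations.RamificationCertificatesProofs
import HarnessLib

/-!
# The inertia groups of `K(x(E[3]))` above `2` from valuation data

`Proofs` file (theorems only, no definitions, no named facts) in topic
`NumberTheory/EllipticCurves`, landed by the seat of bsd.S15
(`Literature.NumberTheory.EllipticCurves.conductorNorm_eq_artinConductorNat_of_isElliptic`),
companion of `ThreeTorsionFakePointSwanProofs` / `ThreeTorsionFakePointProductsProofs`: the
structure of the inertia group `Q₀` and the wild inertia group `Q₁` of `𝔓 ∩ E`, `E = K(x(E[3]))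
= K(R₀, R₁, R₂)` (`R_k² = c₄ - 12ζ^kδ`, `δ³ = Δ`, `ζ = ζ₃`, `R₀R₁R₂ = c₆ ≠ 0`), at a prime `𝔓 ∣ v`,
`v ∣ 2`, `3 ∉ v`, of `\bar ℤ_K`, obtained from **valuations only** (no residue fields, no explicit
Galois groups), as needed to feed `card_mul_swanConductorAt_torsion_three_eq_of_fakePoint_prod`
uniformly on `(c₄, c₆)`-congruence classes (Ogg's formula at `2`, Silverman *ATAEC* IV.11.1, for
`j ≠ 0, 1728`):

* `smul_zeta_eq_of_mem_inertia_xDivisionField_three` — `Q₀` fixes `ζ₃` (`(ζ² - ζ)² = -3 ∉ 𝔓`);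
* `smul_delta_eq_of_mem_ramificationSubgroup_one_xDivisionField_three` — `Q₁` fixes `∛Δ`
  (`Q₁` is a `2`-group, `gδ ∈ {δ, ζδ, ζ²δ}`);
* `smul_radical_eq_or_eq_neg`, `algEquiv_xDivisionField_three_eq_of_smul_radical_eq` — an element
  fixing `ζ, δ` changes signs of the `R_k`, and is determined by its action on `R₀, R₁`;
* `ord_algebraMap_eq_card_inertia_of_mem_primesAbove` — `v_{𝔓 ∩ L}(π) = #G₀(𝔓 ∩ L)` for
  `π ∈ v ∖ v²` (Hilbert theory);
* `card_ramificationSubgroup_one_xDivisionField_three_eq_four` — **`#Q₁ = 4`** from three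
  *odd quadratic defects*: elements `A_k, s_k ∈ S_E` with `A_k = c₄ - 12ζ^kδ` (`= R_k²`), `s_k`
  fixed by every `σ` fixing `ζ, δ`, and `e₀ · v(A_k - s_k²) = t_k · v(π)` with `e₀, t_k` odd,
  `v(A_k - s_k²) ≤ 2 v(2 s_k)`.  (If `#Q₁ ≤ 2` then `Q₁` fixes some `R_k`; in the fixed field `T` of
  `Q₁` one has `v_E = #Q₁ · v_T` and `v_T(π) = #Q₀/#Q₁` odd, so `e₀ v_T(A_k - s_k²) = t_k v_T(π)` is
  odd, contradicting `2 v_T(R_k - s_k) = v_T(A_k - s_k²)` — Neukirch II (6.3) /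
  `two_mul_ord_sub_eq_of_le`.)
* `card_inertia_xDivisionField_three_eq_four` — **`#Q₀ = 4`** if moreover `δ = d · δ₁` with
  `d ∈ 𝓞_K ∖ 0` and `δ₁ ∈ S_E ∖ 𝔓_E` (then `Q₀` fixes `δ`: `(ζ - 1)δ₁ ∈ 𝔓_E` is impossible);
* `card_inertia_xDivisionField_three_eq_twelve` — **`#Q₀ = 12`** if instead `v(Δ) = v_Δ · v(π)` with
  `3 ∤ v_Δ` (`3 ∣ #Q₀`, `4 ∣ #Q₀`, and `g ↦ (i, ±, ±)` with `gδ = ζ^iδ`, `gR₀ = ±R_i`,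
  `gR₁ = ±R_{i+1}` is injective, so `#Q₀ ≤ 12`).

Instance convention as in `ThreeTorsionFakePointSwanProofs` (`IntermediateField.algebra'`,
`AlgebraicClosure.instAlgebra` as the `𝓞 K`-algebra structures on subfields of `K̄`).

## References
* J.-P. Serre, *Local Fields*, GTM 67, Springer 1979, Ch. I §7 (Prop. 20–22), Ch. IV §1–§2
  (`G₁` is a `p`-group: §2 Cor. 3 of Prop. 7). [cite: SerreLocalFields1979, Ch. IV §1–§2]
* J. Neukirch, *Algebraic Number Theory*, Springer 1999, Ch. II §6 (Newton polygon, (6.3)).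
* J. H. Silverman, *Advanced Topics in the Arithmetic of Elliptic Curves*, GTM 151, Springer 1994,
  Ch. IV §10–§11 (Ogg's formula, Thm. 11.1). [cite: SilvermanATAEC1994, Thm. IV.11.1]
-/

noncomputable section

open scoped Classical NumberField Pointwise
open Field IsDedekindDomain Polynomial

attribute [local instance] AddSubgroup.torsionBy.zmodModule
attribute [local instance 1001] IntermediateField.algebra'
attribute [local instance 1002] AlgebraicClosure.instAlgebra

namespace Literature.NumberTheory.EllipticCurves

open Literature.NumberTheory.GaloisRepresentations

variable {K : Type} [Field K] [NumberField K]

/-- **`v_{𝔓 ∩ L}(π) = #G₀(𝔓 ∩ L)`** for `π ∈ 𝓞_K` with `v(π) = 1` (`π ∈ v ∖ v²`) and a finite normal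
`L ⊆ K̄`: `v_{𝔓_L}(π) = e(𝔓_L ∣ v) · v(π)` and `e = #G₀` (Hilbert theory; the residue extension of
a number field is separable). Ref: Serre, *Local Fields*, Ch. I §7 Cor. to Prop. 21.
[cite: SerreLocalFields1979, Ch. I §7 Cor. to Prop. 21] -/
theorem ord_algebraMap_eq_card_inertia_of_mem_primesAbove
    {v : HeightOneSpectrum (𝓞 K)} {𝔓 : Ideal (absIntegers (𝓞 K) K)} (h𝔓 : 𝔓 ∈ v.primesAbove)
    (L : IntermediateField K (AlgebraicClosure K)) [FiniteDimensional K L] [Normal K L]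
    {π : 𝓞 K} (hπ : π ∈ v.asIdeal) (hπ2 : π ∉ v.asIdeal ^ 2) :
    haveI : IsDedekindDomain (integralClosure (𝓞 K) L) := integralClosure.isDedekindDomain (𝓞 K) K L
    ord (𝔓.comap (L.integralClosureToAbsIntegers (𝓞 K))) (algebraMap (𝓞 K) (integralClosure (𝓞 K) L) π) =
      Nat.card ((𝔓.comap (L.integralClosureToAbsIntegers (𝓞 K))).ramificationSubgroup (L ≃ₐ[K] L) 0) := by
  haveI : 𝔓.IsPrime := h𝔓.1
  haveI h𝔓max : 𝔓.IsMaximal := HeightOneSpectrum.isMaximal_of_mem_primesAbove h𝔓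
  haveI : IsGalois K L := {}
  haveI hDD : IsDedekindDomain (integralClosure (𝓞 K) L) := integralClosure.isDedekindDomain (𝓞 K) K L
  haveI hPLmax : (𝔓.comap (L.integralClosureToAbsIntegers (𝓞 K))).IsMaximal :=
    isMaximal_comap_integralClosureToAbsIntegers (𝓞 K) 𝔓 L
  have hunder : (𝔓.comap (L.integralClosureToAbsIntegers (𝓞 K))).under (𝓞 K) = v.asIdeal := by
    rw [under_comap_integralClosureToAbsIntegers, ← h𝔓.2.over]
  have hPL0 : (𝔓.comap (L.integralClosureToAbsIntegers (𝓞 K))) ≠ ⊥ := by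
    intro h0
    have hinj : Function.Injective (algebraMap (𝓞 K) (integralClosure (𝓞 K) L)) :=
      (faithfulSMul_iff_algebraMap_injective _ _).mp (faithfulSMul_integralClosure (𝓞 K) (K := K) (L := L))
    have hπ' : π ∈ (𝔓.comap (L.integralClosureToAbsIntegers (𝓞 K))).under (𝓞 K) := by rw [hunder]; exact hπ
    rw [Ideal.under_def, Ideal.mem_comap, h0, Ideal.mem_bot] at hπ'
    have hπ0 : π = 0 := hinj (hπ'.trans (map_zero _).symm)
    apply hπ2
    rw [hπ0]
    exact Ideal.zero_mem _
  haveI : Finite ((𝓞 K) ⧸ 𝔓.under (𝓞 K)) := by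
    rw [← h𝔓.2.over]; exact Ideal.finiteQuotientOfFreeOfNeBot v.asIdeal v.ne_bot
  haveI hsep : Algebra.IsSeparable
      ((𝓞 K) ⧸ (𝔓.comap (L.integralClosureToAbsIntegers (𝓞 K))).under (𝓞 K))
      (integralClosure (𝓞 K) L ⧸ 𝔓.comap (L.integralClosureToAbsIntegers (𝓞 K))) :=
    isSeparable_residue_comap (𝓞 K) 𝔓 L
  rw [ord_algebraMap (K := K) _ hPL0, ramificationIdx'_under_base_eq_card_inertia (K := K) _ hPL0,
    Ideal.ramificationSubgroup_zero]
  have h1 : ord ((𝔓.comap (L.integralClosureToAbsIntegers (𝓞 K))).under (𝓞 K)) π = 1 := by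
    rw [hunder]
    exact ord_eq_one _ hπ (by exact hπ2)
  rw [h1, mul_one]

end Literature.NumberTheory.EllipticCurves

namespace WeierstrassCurve

open Literature.NumberTheory.EllipticCurves Literature.NumberTheory.GaloisRepresentations

variable {K : Type} [Field K] [NumberField K] (W : WeierstrassCurve K)

/-- **The inertia group of `𝔓 ∩ K(x(E[3]))` fixes `ζ₃`** (`𝔓 ∣ 2`, `3 ∉ 𝔓`): an inertia element
`g` has `gζ - ζ ∈ 𝔓`; if `gζ = ζ²` then `ζ² - ζ ∈ 𝔓`, but `(ζ² - ζ)² = -3 ∉ 𝔓`.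
Ref: Serre, *Local Fields*, Ch. I §7 Prop. 20 (inertia acts trivially on the residue field);
[cite: SerreLocalFields1979, Ch. I §7 Prop. 20] -/
theorem smul_zeta_eq_of_mem_inertia_xDivisionField_three [W.IsElliptic]
    {v : HeightOneSpectrum (𝓞 K)} (h3 : ((3 : ℕ) : 𝓞 K) ∉ v.asIdeal)
    {𝔓 : Ideal (absIntegers (𝓞 K) K)} (h𝔓 : 𝔓 ∈ v.primesAbove)
    {ζ δ R₀ R₁ R₂ : AlgebraicClosure K} (hζ : ζ ^ 2 + ζ + 1 = 0)
    (hδ : δ ^ 3 = algebraMap K (AlgebraicClosure K) W.Δ)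
    (h₀ : R₀ ^ 2 = algebraMap K (AlgebraicClosure K) W.c₄ - 12 * δ)
    (h₁ : R₁ ^ 2 = algebraMap K (AlgebraicClosure K) W.c₄ - 12 * ζ * δ)
    (h₂ : R₂ ^ 2 = algebraMap K (AlgebraicClosure K) W.c₄ - 12 * ζ ^ 2 * δ)
    (hρ : R₀ * R₁ * R₂ = algebraMap K (AlgebraicClosure K) W.c₆)
    {g : W.xDivisionField 3 ≃ₐ[K] W.xDivisionField 3}
    (hg : g ∈ (𝔓.comap ((W.xDivisionField 3).integralClosureToAbsIntegers (𝓞 K))).ramificationSubgroup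
      (W.xDivisionField 3 ≃ₐ[K] W.xDivisionField 3) 0)
    (σ : absoluteGaloisGroup K) (hσ : absRestrictNormalHom (W.xDivisionField 3) σ = g) :
    σ • ζ = ζ := by
  haveI : Fact (Nat.Prime 3) := ⟨Nat.prime_three⟩
  have h2K : (2 : K) ≠ 0 := two_ne_zero
  have h3K : (3 : K) ≠ 0 := three_ne_zero
  haveI : 𝔓.IsPrime := h𝔓.1
  haveI h𝔓max : 𝔓.IsMaximal := HeightOneSpectrum.isMaximal_of_mem_primesAbove h𝔓
  have hunderE : (𝔓.comap ((W.xDivisionField 3).integralClosureToAbsIntegers (𝓞 K))).under (𝓞 K) = v.asIdeal := by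
    rw [under_comap_integralClosureToAbsIntegers, ← h𝔓.2.over]
  have h3E : (3 : integralClosure (𝓞 K) (W.xDivisionField 3)) ∉
      𝔓.comap ((W.xDivisionField 3).integralClosureToAbsIntegers (𝓞 K)) := by
    intro hmem
    apply h3
    rw [← hunderE, Ideal.under_def, Ideal.mem_comap, map_natCast]
    exact_mod_cast hmem
  obtain ⟨mζ, -⟩ := W.zeta_mem_and_delta_mem_xDivisionField_three h2K h3K hζ hδ h₀ h₁ h₂ hρ
  have hζ3 : ζ ^ 3 = 1 := by linear_combination (ζ - 1) * hζ
  have hζmem3 : (⟨ζ, mζ⟩ : W.xDivisionField 3) ^ 3 = 1 := Subtype.ext (by push_cast; exact hζ3)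
  have hζint : _root_.IsIntegral (𝓞 K) (⟨ζ, mζ⟩ : W.xDivisionField 3) :=
    IsIntegral.of_pow three_pos (by rw [hζmem3]; exact isIntegral_one)
  set ζE : integralClosure (𝓞 K) (W.xDivisionField 3) := ⟨⟨ζ, mζ⟩, hζint⟩ with hζEdef
  have hinjE : ∀ {X Y : integralClosure (𝓞 K) (W.xDivisionField 3)},
      ((X : W.xDivisionField 3) : AlgebraicClosure K) = ((Y : W.xDivisionField 3) : AlgebraicClosure K) →
        X = Y := fun h => Subtype.ext (Subtype.ext h)
  have hζE : ζE ^ 2 + ζE + 1 = 0 := hinjE (by push_cast; exact hζ)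
  have hmem := (Ideal.mem_ramificationSubgroup_iff.mp hg).2 ζE
  rw [zero_add, pow_one] at hmem
  have hq : (g • ζE) ^ 2 + g • ζE + 1 = 0 := by
    have : g • (ζE ^ 2 + ζE + 1) = 0 := by rw [hζE, smul_zero]
    rwa [smul_add, smul_add, smul_pow', smul_one] at this
  have hfac : (g • ζE - ζE) * (g • ζE - ζE ^ 2) = 0 := by
    linear_combination hq + (ζE - 1 - g • ζE) * hζE
  have hgζ : g • ζE = ζE := by
    rcases mul_eq_zero.mp hfac with h1 | h1
    · exact sub_eq_zero.mp h1
    · exfalso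
      rw [sub_eq_zero.mp h1] at hmem
      have hsq : (ζE ^ 2 - ζE) ^ 2 = -3 := by linear_combination (ζE ^ 2 - 3 * ζE + 3) * hζE
      apply h3E
      have : (3 : integralClosure (𝓞 K) (W.xDivisionField 3)) = -((ζE ^ 2 - ζE) * (ζE ^ 2 - ζE)) := by
        rw [← sq, hsq, neg_neg]
      rw [this]
      exact neg_mem (Ideal.mul_mem_left _ _ hmem)
  have h : (((g • ζE : integralClosure (𝓞 K) (W.xDivisionField 3)) : W.xDivisionField 3) :
      AlgebraicClosure K) = ((ζE : W.xDivisionField 3) : AlgebraicClosure K) := by rw [hgζ]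
  rw [integralClosure.coe_smul, ← hσ] at h
  exact (AlgEquiv.restrictNormal_commutes (absoluteGaloisGroup.toAlgEquiv K σ) (W.xDivisionField 3) _).symm.trans h

/-- **The wild inertia group of `𝔓 ∩ K(x(E[3]))` fixes `∛Δ`** (`𝔓 ∣ 2`, `3 ∉ 𝔓`): `g ∈ Q₁` fixes `ζ`,
`gδ ∈ {δ, ζδ, ζ²δ}`, and `g` has `2`-power order (`#Q₁ = 2^{v₂(#Q₀)}`), while `3 ∤ 2^a`.
Ref: Serre, *Local Fields*, Ch. IV §2 Cor. 3 of Prop. 7 (`G₁` is a `p`-group).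
[cite: SerreLocalFields1979, Ch. IV §2 Cor. 3] -/
theorem smul_delta_eq_of_mem_ramificationSubgroup_one_xDivisionField_three [W.IsElliptic]
    {v : HeightOneSpectrum (𝓞 K)} (hv2 : (2 : 𝓞 K) ∈ v.asIdeal) (h3 : ((3 : ℕ) : 𝓞 K) ∉ v.asIdeal)
    {𝔓 : Ideal (absIntegers (𝓞 K) K)} (h𝔓 : 𝔓 ∈ v.primesAbove)
    {ζ δ R₀ R₁ R₂ : AlgebraicClosure K} (hζ : ζ ^ 2 + ζ + 1 = 0)
    (hδ : δ ^ 3 = algebraMap K (AlgebraicClosure K) W.Δ)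
    (h₀ : R₀ ^ 2 = algebraMap K (AlgebraicClosure K) W.c₄ - 12 * δ)
    (h₁ : R₁ ^ 2 = algebraMap K (AlgebraicClosure K) W.c₄ - 12 * ζ * δ)
    (h₂ : R₂ ^ 2 = algebraMap K (AlgebraicClosure K) W.c₄ - 12 * ζ ^ 2 * δ)
    (hρ : R₀ * R₁ * R₂ = algebraMap K (AlgebraicClosure K) W.c₆)
    {g : W.xDivisionField 3 ≃ₐ[K] W.xDivisionField 3}
    (hg : g ∈ (𝔓.comap ((W.xDivisionField 3).integralClosureToAbsIntegers (𝓞 K))).ramificationSubgroup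
      (W.xDivisionField 3 ≃ₐ[K] W.xDivisionField 3) 1)
    (σ : absoluteGaloisGroup K) (hσ : absRestrictNormalHom (W.xDivisionField 3) σ = g) :
    σ • δ = δ := by
  haveI : Fact (Nat.Prime 3) := ⟨Nat.prime_three⟩
  haveI : IsGalois K (W.xDivisionField 3) := {}
  have h2K : (2 : K) ≠ 0 := two_ne_zero
  have h3K : (3 : K) ≠ 0 := three_ne_zero
  have hQ10 := Ideal.ramificationSubgroup_antitone
    (𝔓.comap ((W.xDivisionField 3).integralClosureToAbsIntegers (𝓞 K)))
    (W.xDivisionField 3 ≃ₐ[K] W.xDivisionField 3) (Nat.zero_le 1)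
  have hσζ : σ • ζ = ζ :=
    W.smul_zeta_eq_of_mem_inertia_xDivisionField_three h3 h𝔓 hζ hδ h₀ h₁ h₂ hρ (hQ10 hg) σ hσ
  have hδ0 : δ ≠ 0 := by
    intro h0
    rw [h0, zero_pow three_ne_zero] at hδ
    exact W.isUnit_Δ.ne_zero ((_root_.map_eq_zero_iff _ (algebraMap K (AlgebraicClosure K)).injective).mp hδ.symm)
  have hζ1 : ζ ≠ 1 := by
    intro h; rw [h] at hζ; norm_num at hζ
  have hζ3 : ζ ^ 3 = 1 := by linear_combination (ζ - 1) * hζ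
  have hordζ : orderOf ζ = 3 := orderOf_eq_prime hζ3 hζ1
  -- the order of `g` is a power of `2`
  obtain ⟨mζ, mδ⟩ := W.zeta_mem_and_delta_mem_xDivisionField_three h2K h3K hζ hδ h₀ h₁ h₂ hρ
  have hcardpow := card_ramificationSubgroup_one_eq_two_pow_of_mem_primesAbove hv2 h𝔓 (W.xDivisionField 3)
  set a := (Nat.card ((𝔓.comap ((W.xDivisionField 3).integralClosureToAbsIntegers (𝓞 K))).ramificationSubgroup
      (W.xDivisionField 3 ≃ₐ[K] W.xDivisionField 3) 0)).factorization 2 with ha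
  have hgpow : g ^ (2 ^ a) = 1 := by
    have h := orderOf_dvd_natCard (⟨g, hg⟩ : (𝔓.comap ((W.xDivisionField 3).integralClosureToAbsIntegers (𝓞 K))).ramificationSubgroup
      (W.xDivisionField 3 ≃ₐ[K] W.xDivisionField 3) 1)
    rw [hcardpow, orderOf_dvd_iff_pow_eq_one] at h
    exact congrArg Subtype.val h
  -- work with the field elements `ζ', δ' ∈ E`
  set ζ' : W.xDivisionField 3 := ⟨ζ, mζ⟩ with hζ'
  set δ' : W.xDivisionField 3 := ⟨δ, mδ⟩ with hδ'
  have hval : ∀ e : W.xDivisionField 3, ((g e : W.xDivisionField 3) : AlgebraicClosure K) =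
      σ • (e : AlgebraicClosure K) := by
    intro e
    rw [← hσ]
    exact AlgEquiv.restrictNormal_commutes (absoluteGaloisGroup.toAlgEquiv K σ) (W.xDivisionField 3) e
  have hgζ : g ζ' = ζ' := Subtype.ext (by rw [hval]; exact hσζ)
  have hζ'rel : ζ' ^ 2 + ζ' + 1 = 0 := Subtype.ext (by push_cast; exact hζ)
  have hδ'3 : δ' ^ 3 = algebraMap K (W.xDivisionField 3) W.Δ := Subtype.ext (by push_cast; exact hδ)
  have hcube : (g δ') ^ 3 = δ' ^ 3 := by rw [← map_pow, hδ'3, AlgEquiv.commutes]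
  have hfac : (g δ' - δ') * (g δ' - ζ' * δ') * (g δ' - ζ' ^ 2 * δ') = 0 := by
    linear_combination hcube + (-(δ' * (g δ') ^ 2) + ζ' * δ' ^ 2 * (g δ') - (ζ' - 1) * δ' ^ 3) * hζ'rel
  -- iterates: `gδ = ζ^i δ ⇒ g^k δ = ζ^{ik} δ`
  have hgζk : ∀ k : ℕ, (g ^ k) ζ' = ζ' := by
    intro k
    induction k with
    | zero => simp
    | succ k ih => rw [pow_succ, AlgEquiv.mul_apply, hgζ, ih]
  have hiter : ∀ i : ℕ, g δ' = ζ' ^ i * δ' → ∀ k : ℕ, (g ^ k) δ' = ζ' ^ (i * k) * δ' := by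
    intro i hi k
    induction k with
    | zero => simp
    | succ k ih =>
      rw [pow_succ, AlgEquiv.mul_apply, hi, map_mul, map_pow, hgζk k, ih]
      ring
  have hδ'0 : δ' ≠ 0 := fun h0 => hδ0 (by rw [← show ((δ' : W.xDivisionField 3) : AlgebraicClosure K) = δ from rfl, h0]; rfl)
  have key : ∀ i : ℕ, g δ' = ζ' ^ i * δ' → 3 ∣ i * 2 ^ a := by
    intro i hi
    have h := hiter i hi (2 ^ a)
    rw [hgpow, AlgEquiv.one_apply] at h
    have h1 : (ζ' ^ (i * 2 ^ a) - 1) * δ' = 0 := by linear_combination (-1 : W.xDivisionField 3) * h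
    rcases mul_eq_zero.mp h1 with h2 | h2
    · have h3 : ζ ^ (i * 2 ^ a) = 1 := by
        have := congrArg (fun e : W.xDivisionField 3 => (e : AlgebraicClosure K)) (sub_eq_zero.mp h2)
        push_cast at this
        exact this
      rw [← hordζ]
      exact orderOf_dvd_of_pow_eq_one h3
    · exact absurd h2 hδ'0
  have hnot : ∀ i : ℕ, i = 1 ∨ i = 2 → ¬ 3 ∣ i * 2 ^ a := by
    rintro i (rfl | rfl) hd
    · rw [one_mul] at hd
      exact absurd (Nat.Prime.dvd_of_dvd_pow Nat.prime_three hd) (by norm_num)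
    · rw [show 2 * 2 ^ a = 2 ^ (a + 1) by ring] at hd
      exact absurd (Nat.Prime.dvd_of_dvd_pow Nat.prime_three hd) (by norm_num)
  have hgδ : g δ' = δ' := by
    rcases mul_eq_zero.mp hfac with h12 | h3c
    · rcases mul_eq_zero.mp h12 with h1 | h2c
      · exact sub_eq_zero.mp h1
      · exact absurd (key 1 (by rw [pow_one]; exact sub_eq_zero.mp h2c)) (hnot 1 (Or.inl rfl))
    · exact absurd (key 2 (sub_eq_zero.mp h3c)) (hnot 2 (Or.inr rfl))
  have h : ((g δ' : W.xDivisionField 3) : AlgebraicClosure K) = ((δ' : W.xDivisionField 3) : AlgebraicClosure K) := by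
    rw [hgδ]
  rw [hval] at h
  exact h

omit [NumberField K] in
/-- **Signs**: if `σ ∈ Γ_K` fixes `ζ` and `δ` then `σ R_k = ± R_k` (`(σR_k)² = σ(c₄ - 12ζ^kδ) = R_k²`).
[folklore] -/
theorem smul_radical_eq_or_eq_neg {ζ δ R₀ R₁ R₂ : AlgebraicClosure K}
    (h₀ : R₀ ^ 2 = algebraMap K (AlgebraicClosure K) W.c₄ - 12 * δ)
    (h₁ : R₁ ^ 2 = algebraMap K (AlgebraicClosure K) W.c₄ - 12 * ζ * δ)
    (h₂ : R₂ ^ 2 = algebraMap K (AlgebraicClosure K) W.c₄ - 12 * ζ ^ 2 * δ)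
    {σ : absoluteGaloisGroup K} (hσζ : σ • ζ = ζ) (hσδ : σ • δ = δ) :
    (σ • R₀ = R₀ ∨ σ • R₀ = -R₀) ∧ (σ • R₁ = R₁ ∨ σ • R₁ = -R₁) ∧ (σ • R₂ = R₂ ∨ σ • R₂ = -R₂) := by
  have hc4 : σ • algebraMap K (AlgebraicClosure K) W.c₄ = algebraMap K (AlgebraicClosure K) W.c₄ :=
    smul_algebraMap σ W.c₄
  have e12 : σ • (12 : AlgebraicClosure K) = 12 := by
    rw [show (12 : AlgebraicClosure K) = algebraMap K (AlgebraicClosure K) 12 from (map_ofNat _ 12).symm]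
    exact smul_algebraMap σ (12 : K)
  have key : ∀ (R A : AlgebraicClosure K), R ^ 2 = A → σ • A = A → σ • R = R ∨ σ • R = -R := by
    intro R A hR hA
    have h' : (σ • R) ^ 2 = R ^ 2 := by rw [← smul_pow', hR, hA]
    have hm : (σ • R - R) * (σ • R + R) = 0 := by linear_combination h'
    rcases mul_eq_zero.mp hm with h | h
    · exact Or.inl (sub_eq_zero.mp h)
    · exact Or.inr (eq_neg_of_add_eq_zero_left h)
  refine ⟨key R₀ _ h₀ ?_, key R₁ _ h₁ ?_, key R₂ _ h₂ ?_⟩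
  · rw [smul_sub, smul_mul', hc4, e12, hσδ]
  · rw [smul_sub, smul_mul', smul_mul', hc4, e12, hσζ, hσδ]
  · rw [smul_sub, smul_mul', smul_mul', smul_pow', hc4, e12, hσζ, hσδ]

/-- **An automorphism of `K(x(E[3])) = K(R₀, R₁, R₂)` is determined by `R₀, R₁`** (`c₆ ≠ 0`): if
lifts `σ, σ'` of `g, g'` agree on `R₀` and `R₁`, they agree on `R₂ = c₆/(R₀R₁)`, and `g = g'`
(`absRestrictNormalHom_xDivisionField_three_eq_one_iff_radical`). [folklore] -/
theorem algEquiv_xDivisionField_three_eq_of_smul_radical_eq [W.IsElliptic]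
    {ζ δ R₀ R₁ R₂ : AlgebraicClosure K} (hζ : ζ ^ 2 + ζ + 1 = 0)
    (hδ : δ ^ 3 = algebraMap K (AlgebraicClosure K) W.Δ)
    (h₀ : R₀ ^ 2 = algebraMap K (AlgebraicClosure K) W.c₄ - 12 * δ)
    (h₁ : R₁ ^ 2 = algebraMap K (AlgebraicClosure K) W.c₄ - 12 * ζ * δ)
    (h₂ : R₂ ^ 2 = algebraMap K (AlgebraicClosure K) W.c₄ - 12 * ζ ^ 2 * δ)
    (hρ : R₀ * R₁ * R₂ = algebraMap K (AlgebraicClosure K) W.c₆) (hc₆ : W.c₆ ≠ 0)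
    {g g' : W.xDivisionField 3 ≃ₐ[K] W.xDivisionField 3} {σ σ' : absoluteGaloisGroup K}
    (hσ : absRestrictNormalHom (W.xDivisionField 3) σ = g)
    (hσ' : absRestrictNormalHom (W.xDivisionField 3) σ' = g')
    (e0 : σ • R₀ = σ' • R₀) (e1 : σ • R₁ = σ' • R₁) : g = g' := by
  have hRne : R₀ ≠ 0 ∧ R₁ ≠ 0 := by
    have hprod : R₀ * R₁ * R₂ ≠ 0 := by
      rw [hρ]; exact (_root_.map_ne_zero _).mpr hc₆
    exact ⟨fun h => hprod (by rw [h]; ring), fun h => hprod (by rw [h]; ring)⟩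
  have hρσ : ∀ τ : absoluteGaloisGroup K, (τ • R₀) * (τ • R₁) * (τ • R₂) = R₀ * R₁ * R₂ := by
    intro τ
    rw [← smul_mul', ← smul_mul', hρ, smul_algebraMap]
  have t0 : (σ⁻¹ * σ') • R₀ = R₀ := by rw [mul_smul, ← e0, inv_smul_smul]
  have t1 : (σ⁻¹ * σ') • R₁ = R₁ := by rw [mul_smul, ← e1, inv_smul_smul]
  have t2 : (σ⁻¹ * σ') • R₂ = R₂ := by
    have h := hρσ (σ⁻¹ * σ')
    rw [t0, t1] at h
    exact mul_left_cancel₀ (mul_ne_zero hRne.1 hRne.2) h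
  have h1 := (W.absRestrictNormalHom_xDivisionField_three_eq_one_iff_radical hζ hδ h₀ h₁ h₂ hρ
    (σ⁻¹ * σ')).mpr ⟨t0, t1, t2⟩
  rw [map_mul, map_inv, hσ, hσ', inv_mul_eq_one] at h1
  exact h1

set_option maxHeartbeats 1600000 in
set_option synthInstance.maxHeartbeats 400000 in
/-- **`#Q₁(𝔓 ∩ K(x(E[3]))) = 4` from three odd quadratic defects.**  `K` a number field, `v ∣ 2`,
`3 ∉ v`, `𝔓 ∣ v` a prime of `\bar ℤ_K`, radicals `ζ, δ, R_k` of `E[3]` with `c₆ ≠ 0`, `π ∈ v ∖ v²`;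
elements `A_k, s_k ∈ S_E` (`E = K(x(E[3]))`) with `A_k = c₄ - 12ζ^kδ`, `s_k` fixed by every
`σ ∈ Γ_K` fixing `ζ` and `δ`, and natural numbers `e₀, t_k` odd with
`e₀ · v_{𝔓_E}(A_k - s_k²) = t_k · v_{𝔓_E}(π)` and `v_{𝔓_E}(A_k - s_k²) ≤ 2 v_{𝔓_E}(2 s_k)`
(`k = 0, 1, 2`).  Then the wild inertia group of `𝔓 ∩ E` has order `4` (it is the four-group of
even sign changes of `(R₀, R₁, R₂)`).
Proof: `Q₁` embeds in `{±1}²` (it fixes `ζ, δ`); if `#Q₁ ≤ 2` it fixes some `R_k`; in the fixed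
field `T` of `Q₁`, `v_{𝔓_E} = #Q₁ · v_{𝔓_T}` on `S_T` and `v_{𝔓_T}(π) = #Q₀ / #Q₁` is odd
(`#Q₁ = 2^{v₂(#Q₀)}`), so `v_{𝔓_T}(A_k - s_k²)·e₀ = t_k v_{𝔓_T}(π)` is odd, while
`2 v_{𝔓_T}(R_k - s_k) = v_{𝔓_T}(A_k - s_k²)` (one-slope lemma).
Ref: Serre, *Local Fields*, Ch. I §7 Prop. 21–22, Ch. IV §2 Cor. 3; Neukirch, *ANT* II (6.3).
[cite: SerreLocalFields1979, Ch. I §7 Prop. 22] -/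
theorem card_ramificationSubgroup_one_xDivisionField_three_eq_four [W.IsElliptic]
    {v : HeightOneSpectrum (𝓞 K)} (hv2 : (2 : 𝓞 K) ∈ v.asIdeal) (h3 : ((3 : ℕ) : 𝓞 K) ∉ v.asIdeal)
    {𝔓 : Ideal (absIntegers (𝓞 K) K)} (h𝔓 : 𝔓 ∈ v.primesAbove)
    {ζ δ R₀ R₁ R₂ : AlgebraicClosure K} (hζ : ζ ^ 2 + ζ + 1 = 0)
    (hδ : δ ^ 3 = algebraMap K (AlgebraicClosure K) W.Δ)
    (h₀ : R₀ ^ 2 = algebraMap K (AlgebraicClosure K) W.c₄ - 12 * δ)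
    (h₁ : R₁ ^ 2 = algebraMap K (AlgebraicClosure K) W.c₄ - 12 * ζ * δ)
    (h₂ : R₂ ^ 2 = algebraMap K (AlgebraicClosure K) W.c₄ - 12 * ζ ^ 2 * δ)
    (hρ : R₀ * R₁ * R₂ = algebraMap K (AlgebraicClosure K) W.c₆) (hc₆ : W.c₆ ≠ 0)
    {π : 𝓞 K} (hπ : π ∈ v.asIdeal) (hπ2 : π ∉ v.asIdeal ^ 2)
    {A₀ A₁ A₂ s₀ s₁ s₂ : integralClosure (𝓞 K) (W.xDivisionField 3)}
    (hA₀ : ((A₀ : W.xDivisionField 3) : AlgebraicClosure K) = algebraMap K (AlgebraicClosure K) W.c₄ - 12 * δ)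
    (hA₁ : ((A₁ : W.xDivisionField 3) : AlgebraicClosure K) = algebraMap K (AlgebraicClosure K) W.c₄ - 12 * ζ * δ)
    (hA₂ : ((A₂ : W.xDivisionField 3) : AlgebraicClosure K) = algebraMap K (AlgebraicClosure K) W.c₄ - 12 * ζ ^ 2 * δ)
    (hs₀ : ∀ σ : absoluteGaloisGroup K, σ • ζ = ζ → σ • δ = δ →
      σ • ((s₀ : W.xDivisionField 3) : AlgebraicClosure K) = ((s₀ : W.xDivisionField 3) : AlgebraicClosure K))
    (hs₁ : ∀ σ : absoluteGaloisGroup K, σ • ζ = ζ → σ • δ = δ →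
      σ • ((s₁ : W.xDivisionField 3) : AlgebraicClosure K) = ((s₁ : W.xDivisionField 3) : AlgebraicClosure K))
    (hs₂ : ∀ σ : absoluteGaloisGroup K, σ • ζ = ζ → σ • δ = δ →
      σ • ((s₂ : W.xDivisionField 3) : AlgebraicClosure K) = ((s₂ : W.xDivisionField 3) : AlgebraicClosure K))
    {e₀ t₀ t₁ t₂ : ℕ} (he₀ : Odd e₀) (hto₀ : Odd t₀) (hto₁ : Odd t₁) (hto₂ : Odd t₂)
    (ht₀ : (e₀ : ℕ∞) * ord (𝔓.comap ((W.xDivisionField 3).integralClosureToAbsIntegers (𝓞 K))) (A₀ - s₀ ^ 2) =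
      t₀ * ord (𝔓.comap ((W.xDivisionField 3).integralClosureToAbsIntegers (𝓞 K)))
        (algebraMap (𝓞 K) (integralClosure (𝓞 K) (W.xDivisionField 3)) π))
    (ht₁ : (e₀ : ℕ∞) * ord (𝔓.comap ((W.xDivisionField 3).integralClosureToAbsIntegers (𝓞 K))) (A₁ - s₁ ^ 2) =
      t₁ * ord (𝔓.comap ((W.xDivisionField 3).integralClosureToAbsIntegers (𝓞 K)))
        (algebraMap (𝓞 K) (integralClosure (𝓞 K) (W.xDivisionField 3)) π))
    (ht₂ : (e₀ : ℕ∞) * ord (𝔓.comap ((W.xDivisionField 3).integralClosureToAbsIntegers (𝓞 K))) (A₂ - s₂ ^ 2) =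
      t₂ * ord (𝔓.comap ((W.xDivisionField 3).integralClosureToAbsIntegers (𝓞 K)))
        (algebraMap (𝓞 K) (integralClosure (𝓞 K) (W.xDivisionField 3)) π))
    (hle₀ : ord (𝔓.comap ((W.xDivisionField 3).integralClosureToAbsIntegers (𝓞 K))) (A₀ - s₀ ^ 2) ≤
      2 * ord (𝔓.comap ((W.xDivisionField 3).integralClosureToAbsIntegers (𝓞 K))) (2 * s₀))
    (hle₁ : ord (𝔓.comap ((W.xDivisionField 3).integralClosureToAbsIntegers (𝓞 K))) (A₁ - s₁ ^ 2) ≤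
      2 * ord (𝔓.comap ((W.xDivisionField 3).integralClosureToAbsIntegers (𝓞 K))) (2 * s₁))
    (hle₂ : ord (𝔓.comap ((W.xDivisionField 3).integralClosureToAbsIntegers (𝓞 K))) (A₂ - s₂ ^ 2) ≤
      2 * ord (𝔓.comap ((W.xDivisionField 3).integralClosureToAbsIntegers (𝓞 K))) (2 * s₂)) :
    Nat.card ((𝔓.comap ((W.xDivisionField 3).integralClosureToAbsIntegers (𝓞 K))).ramificationSubgroup
      (W.xDivisionField 3 ≃ₐ[K] W.xDivisionField 3) 1) = 4 := by
  classical
  haveI : Fact (Nat.Prime 3) := ⟨Nat.prime_three⟩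
  have h2K : (2 : K) ≠ 0 := two_ne_zero
  have h3K : (3 : K) ≠ 0 := three_ne_zero
  -- instances for `E = K(x(E[3]))`
  haveI hDDE : IsDedekindDomain (integralClosure (𝓞 K) (W.xDivisionField 3)) :=
    integralClosure.isDedekindDomain (𝓞 K) K (W.xDivisionField 3)
  haveI : 𝔓.IsPrime := h𝔓.1
  haveI h𝔓max : 𝔓.IsMaximal := HeightOneSpectrum.isMaximal_of_mem_primesAbove h𝔓
  haveI : IsGalois K (W.xDivisionField 3) := {}
  haveI hPEmax : (𝔓.comap ((W.xDivisionField 3).integralClosureToAbsIntegers (𝓞 K))).IsMaximal :=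
    isMaximal_comap_integralClosureToAbsIntegers (𝓞 K) 𝔓 (W.xDivisionField 3)
  have hunderE : (𝔓.comap ((W.xDivisionField 3).integralClosureToAbsIntegers (𝓞 K))).under (𝓞 K) = v.asIdeal := by
    rw [under_comap_integralClosureToAbsIntegers, ← h𝔓.2.over]
  have hPE0 : (𝔓.comap ((W.xDivisionField 3).integralClosureToAbsIntegers (𝓞 K))) ≠ ⊥ := by
    intro h0
    have hinj : Function.Injective (algebraMap (𝓞 K) (integralClosure (𝓞 K) (W.xDivisionField 3))) :=
      (faithfulSMul_iff_algebraMap_injective _ _).mp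
        (faithfulSMul_integralClosure (𝓞 K) (K := K) (L := (W.xDivisionField 3)))
    have h2' : (2 : 𝓞 K) ∈ (𝔓.comap ((W.xDivisionField 3).integralClosureToAbsIntegers (𝓞 K))).under (𝓞 K) := by
      rw [hunderE]; exact hv2
    rw [Ideal.under_def, Ideal.mem_comap, h0, Ideal.mem_bot] at h2'
    exact two_ne_zero (hinj (h2'.trans (map_zero _).symm))
  haveI : Finite ((𝓞 K) ⧸ 𝔓.under (𝓞 K)) := by
    rw [← h𝔓.2.over]; exact Ideal.finiteQuotientOfFreeOfNeBot v.asIdeal v.ne_bot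
  haveI hsepE : Algebra.IsSeparable
      ((𝓞 K) ⧸ (𝔓.comap ((W.xDivisionField 3).integralClosureToAbsIntegers (𝓞 K))).under (𝓞 K))
      (integralClosure (𝓞 K) (W.xDivisionField 3) ⧸
        𝔓.comap ((W.xDivisionField 3).integralClosureToAbsIntegers (𝓞 K))) :=
    isSeparable_residue_comap (𝓞 K) 𝔓 (W.xDivisionField 3)
  -- radicals in `E`
  obtain ⟨mR₀, mR₁, mR₂⟩ := W.radical_mem_xDivisionField_three h2K h3K hζ hδ h₀ h₁ h₂ hρ
  have hRne : R₀ ≠ 0 ∧ R₁ ≠ 0 ∧ R₂ ≠ 0 := by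
    have hprod : R₀ * R₁ * R₂ ≠ 0 := by
      rw [hρ]; exact (_root_.map_ne_zero _).mpr hc₆
    exact ⟨fun h => hprod (by rw [h]; ring), fun h => hprod (by rw [h]; ring), fun h => hprod (by rw [h]; ring)⟩
  have hρσ : ∀ σ : absoluteGaloisGroup K, (σ • R₀) * (σ • R₁) * (σ • R₂) = R₀ * R₁ * R₂ := by
    intro σ
    rw [← smul_mul', ← smul_mul', hρ, smul_algebraMap]
  have hres : ∀ (g : W.xDivisionField 3 ≃ₐ[K] W.xDivisionField 3) (σ : absoluteGaloisGroup K),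
      absRestrictNormalHom (W.xDivisionField 3) σ = g →
      ∀ X : integralClosure (𝓞 K) (W.xDivisionField 3),
        (((g • X : integralClosure (𝓞 K) (W.xDivisionField 3)) : W.xDivisionField 3) : AlgebraicClosure K) =
          σ • ((X : W.xDivisionField 3) : AlgebraicClosure K) := by
    intro g σ hσ X
    rw [integralClosure.coe_smul, ← hσ]
    exact AlgEquiv.restrictNormal_commutes (absoluteGaloisGroup.toAlgEquiv K σ) (W.xDivisionField 3) X
  have hresf : ∀ (g : W.xDivisionField 3 ≃ₐ[K] W.xDivisionField 3) (σ : absoluteGaloisGroup K),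
      absRestrictNormalHom (W.xDivisionField 3) σ = g →
      ∀ e : W.xDivisionField 3, ((g e : W.xDivisionField 3) : AlgebraicClosure K) =
        σ • (e : AlgebraicClosure K) := by
    intro g σ hσ e
    rw [← hσ]
    exact AlgEquiv.restrictNormal_commutes (absoluteGaloisGroup.toAlgEquiv K σ) (W.xDivisionField 3) e
  have hinjE : ∀ {X Y : integralClosure (𝓞 K) (W.xDivisionField 3)},
      ((X : W.xDivisionField 3) : AlgebraicClosure K) = ((Y : W.xDivisionField 3) : AlgebraicClosure K) →
        X = Y := fun h => Subtype.ext (Subtype.ext h)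
  -- `Q₁`, its elements fix `ζ, δ`
  obtain ⟨Q1, hQ1⟩ : ∃ Q1 : Subgroup (W.xDivisionField 3 ≃ₐ[K] W.xDivisionField 3),
      Q1 = (𝔓.comap ((W.xDivisionField 3).integralClosureToAbsIntegers (𝓞 K))).ramificationSubgroup
        (W.xDivisionField 3 ≃ₐ[K] W.xDivisionField 3) 1 := ⟨_, rfl⟩
  rw [← hQ1]
  have hmem1 : ∀ g, g ∈ Q1 → g ∈ (𝔓.comap ((W.xDivisionField 3).integralClosureToAbsIntegers (𝓞 K))).ramificationSubgroup
      (W.xDivisionField 3 ≃ₐ[K] W.xDivisionField 3) 1 := fun g hg => hQ1 ▸ hg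
  have hQ10 : ∀ g, g ∈ Q1 → g ∈ (𝔓.comap ((W.xDivisionField 3).integralClosureToAbsIntegers (𝓞 K))).ramificationSubgroup
      (W.xDivisionField 3 ≃ₐ[K] W.xDivisionField 3) 0 :=
    fun g hg => Ideal.ramificationSubgroup_antitone _ _ (Nat.zero_le 1) (hmem1 g hg)
  have hliftfix : ∀ g, g ∈ Q1 → ∀ σ : absoluteGaloisGroup K, absRestrictNormalHom (W.xDivisionField 3) σ = g →
      σ • ζ = ζ ∧ σ • δ = δ := fun g hg σ hσ =>
    ⟨W.smul_zeta_eq_of_mem_inertia_xDivisionField_three h3 h𝔓 hζ hδ h₀ h₁ h₂ hρ (hQ10 g hg) σ hσ,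
     W.smul_delta_eq_of_mem_ramificationSubgroup_one_xDivisionField_three hv2 h3 h𝔓 hζ hδ h₀ h₁ h₂ hρ
      (hmem1 g hg) σ hσ⟩
  -- the sign map `Q₁ → {±1}²` is injective: `#Q₁ ≤ 4`
  have hval : ∀ (g : W.xDivisionField 3 ≃ₐ[K] W.xDivisionField 3) (σ : absoluteGaloisGroup K),
      absRestrictNormalHom (W.xDivisionField 3) σ = g → ∀ (R : AlgebraicClosure K) (hR : R ∈ W.xDivisionField 3),
      (g ⟨R, hR⟩ = ⟨R, hR⟩ ↔ σ • R = R) := by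
    intro g σ hσ R hR
    rw [Subtype.ext_iff, hresf g σ hσ]
  let f : Q1 → Bool × Bool := fun g =>
    (decide ((g : W.xDivisionField 3 ≃ₐ[K] W.xDivisionField 3) ⟨R₀, mR₀⟩ = ⟨R₀, mR₀⟩),
     decide ((g : W.xDivisionField 3 ≃ₐ[K] W.xDivisionField 3) ⟨R₁, mR₁⟩ = ⟨R₁, mR₁⟩))
  have hf_inj : Function.Injective f := by
    rintro ⟨g, hg⟩ ⟨g', hg'⟩ hgg'
    simp only [f, Prod.mk.injEq, decide_eq_decide] at hgg'
    obtain ⟨e0, e1⟩ := hgg'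
    obtain ⟨σ, hσ⟩ := absRestrictNormalHom_surjective' (W.xDivisionField 3) g
    obtain ⟨σ', hσ'⟩ := absRestrictNormalHom_surjective' (W.xDivisionField 3) g'
    obtain ⟨fζ, fδ⟩ := hliftfix g hg σ hσ
    obtain ⟨fζ', fδ'⟩ := hliftfix g' hg' σ' hσ'
    obtain ⟨s0, s1, -⟩ := W.smul_radical_eq_or_eq_neg h₀ h₁ h₂ fζ fδ
    obtain ⟨s0', s1', -⟩ := W.smul_radical_eq_or_eq_neg h₀ h₁ h₂ fζ' fδ'
    rw [hval g σ hσ, hval g' σ' hσ'] at e0 e1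
    have a0 : σ • R₀ = σ' • R₀ := by
      rcases s0 with h | h
      · rw [h, e0.mp h]
      · rcases s0' with h' | h'
        · rw [h', e0.mpr h']
        · rw [h, h']
    have a1 : σ • R₁ = σ' • R₁ := by
      rcases s1 with h | h
      · rw [h, e1.mp h]
      · rcases s1' with h' | h'
        · rw [h', e1.mpr h']
        · rw [h, h']
    exact Subtype.ext (W.algEquiv_xDivisionField_three_eq_of_smul_radical_eq hζ hδ h₀ h₁ h₂ hρ hc₆ hσ hσ' a0 a1)
  have hle4 : Nat.card Q1 ≤ 4 := by
    have h := Nat.card_le_card_of_injective f hf_inj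
    rwa [Nat.card_prod, show Nat.card Bool = 2 by simp] at h
  -- `#Q₁ = 2^a`
  have hcardpow : Nat.card Q1 = 2 ^ (Nat.card ((𝔓.comap ((W.xDivisionField 3).integralClosureToAbsIntegers (𝓞 K))).ramificationSubgroup
      (W.xDivisionField 3 ≃ₐ[K] W.xDivisionField 3) 0)).factorization 2 := by
    rw [hQ1]; exact card_ramificationSubgroup_one_eq_two_pow_of_mem_primesAbove hv2 h𝔓 (W.xDivisionField 3)
  -- `v_{𝔓_E}(π) = #Q₀`
  have hordπ := ord_algebraMap_eq_card_inertia_of_mem_primesAbove h𝔓 (W.xDivisionField 3) hπ hπ2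
  -- the core: no `R ∈ E` with `R² = A`, `R, A, s` fixed by `Q₁`, `e₀ v(A - s²) = t v(π)`, `t` odd
  have core : ∀ (R : AlgebraicClosure K) (mR : R ∈ W.xDivisionField 3)
      (A s : integralClosure (𝓞 K) (W.xDivisionField 3)) (t : ℕ),
      ((A : W.xDivisionField 3) : AlgebraicClosure K) = R ^ 2 →
      (∀ g, g ∈ Q1 → ∀ σ : absoluteGaloisGroup K, absRestrictNormalHom (W.xDivisionField 3) σ = g → σ • R = R) →
      (∀ g, g ∈ Q1 → ∀ σ : absoluteGaloisGroup K, absRestrictNormalHom (W.xDivisionField 3) σ = g →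
        σ • ((A : W.xDivisionField 3) : AlgebraicClosure K) = ((A : W.xDivisionField 3) : AlgebraicClosure K)) →
      (∀ g, g ∈ Q1 → ∀ σ : absoluteGaloisGroup K, absRestrictNormalHom (W.xDivisionField 3) σ = g →
        σ • ((s : W.xDivisionField 3) : AlgebraicClosure K) = ((s : W.xDivisionField 3) : AlgebraicClosure K)) →
      Odd t →
      (e₀ : ℕ∞) * ord (𝔓.comap ((W.xDivisionField 3).integralClosureToAbsIntegers (𝓞 K))) (A - s ^ 2) =
        t * ord (𝔓.comap ((W.xDivisionField 3).integralClosureToAbsIntegers (𝓞 K)))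
          (algebraMap (𝓞 K) (integralClosure (𝓞 K) (W.xDivisionField 3)) π) →
      ord (𝔓.comap ((W.xDivisionField 3).integralClosureToAbsIntegers (𝓞 K))) (A - s ^ 2) ≤
        2 * ord (𝔓.comap ((W.xDivisionField 3).integralClosureToAbsIntegers (𝓞 K))) (2 * s) → False := by
    intro R mR A s t hAR hfixR hfixA hfixs hto ht hle
    -- the fixed field `T₁` of `Q₁` and its ring of integers
    set T₁ : IntermediateField K (W.xDivisionField 3) := IntermediateField.fixedField Q1 with hT₁
    have hfixT : T₁.fixingSubgroup = Q1 := IntermediateField.fixingSubgroup_fixedField Q1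
    have hmemT : ∀ X : integralClosure (𝓞 K) (W.xDivisionField 3),
        (∀ g, g ∈ Q1 → ∀ σ : absoluteGaloisGroup K, absRestrictNormalHom (W.xDivisionField 3) σ = g →
          σ • ((X : W.xDivisionField 3) : AlgebraicClosure K) = ((X : W.xDivisionField 3) : AlgebraicClosure K)) →
        (X : W.xDivisionField 3) ∈ T₁ := by
      intro X hX
      rw [hT₁, IntermediateField.mem_fixedField_iff]
      intro g hg
      obtain ⟨σ, hσ⟩ := absRestrictNormalHom_surjective' (W.xDivisionField 3) g
      apply Subtype.ext
      rw [hresf g σ hσ]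
      exact hX g hg σ hσ
    have hRmemT : (⟨R, mR⟩ : W.xDivisionField 3) ∈ T₁ := by
      rw [hT₁, IntermediateField.mem_fixedField_iff]
      intro g hg
      obtain ⟨σ, hσ⟩ := absRestrictNormalHom_surjective' (W.xDivisionField 3) g
      apply Subtype.ext
      rw [hresf g σ hσ]
      exact hfixR g hg σ hσ
    have hinjT : Function.Injective (algebraMap T₁ (W.xDivisionField 3)) := (algebraMap T₁ (W.xDivisionField 3)).injective
    haveI hIST : IsScalarTower (𝓞 K) T₁ (W.xDivisionField 3) := IsScalarTower.of_algebraMap_eq (fun x => rfl)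
    -- integral elements of `T₁`
    have hint : ∀ (X : integralClosure (𝓞 K) (W.xDivisionField 3)) (hX : (X : W.xDivisionField 3) ∈ T₁),
        _root_.IsIntegral (𝓞 K) (⟨(X : W.xDivisionField 3), hX⟩ : T₁) := by
      intro X hX
      rw [← isIntegral_algebraMap_iff hinjT]
      exact X.2
    set AT : integralClosure (𝓞 K) T₁ := ⟨⟨(A : W.xDivisionField 3), hmemT A hfixA⟩, hint A _⟩ with hAT
    set sT : integralClosure (𝓞 K) T₁ := ⟨⟨(s : W.xDivisionField 3), hmemT s hfixs⟩, hint s _⟩ with hsT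
    have hRTint : _root_.IsIntegral (𝓞 K) (⟨(⟨R, mR⟩ : W.xDivisionField 3), hRmemT⟩ : T₁) := by
      refine IsIntegral.of_pow two_pos ?_
      have hsq : (⟨(⟨R, mR⟩ : W.xDivisionField 3), hRmemT⟩ : T₁) ^ 2 = ⟨(A : W.xDivisionField 3), hmemT A hfixA⟩ := by
        apply Subtype.ext; apply Subtype.ext
        push_cast
        exact hAR.symm
      rw [hsq]
      exact hint A _
    set RT : integralClosure (𝓞 K) T₁ := ⟨⟨(⟨R, mR⟩ : W.xDivisionField 3), hRmemT⟩, hRTint⟩ with hRT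
    set πT : integralClosure (𝓞 K) T₁ := algebraMap (𝓞 K) (integralClosure (𝓞 K) T₁) π with hπT
    -- the transfer `S_{T₁} → S_E`
    letI algT : Algebra (integralClosure (𝓞 K) T₁) (integralClosure (𝓞 K) (W.xDivisionField 3)) :=
      integralClosureAlgebra (𝓞 K) T₁
    haveI hDDT : IsDedekindDomain (integralClosure (𝓞 K) T₁) := integralClosure.isDedekindDomain (𝓞 K) K T₁
    have hmapA : algebraMap (integralClosure (𝓞 K) T₁) (integralClosure (𝓞 K) (W.xDivisionField 3)) AT = A := by
      apply Subtype.ext; rfl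
    have hmaps : algebraMap (integralClosure (𝓞 K) T₁) (integralClosure (𝓞 K) (W.xDivisionField 3)) sT = s := by
      apply Subtype.ext; rfl
    have hmapπ : algebraMap (integralClosure (𝓞 K) T₁) (integralClosure (𝓞 K) (W.xDivisionField 3)) πT =
        algebraMap (𝓞 K) (integralClosure (𝓞 K) (W.xDivisionField 3)) π := by
      apply Subtype.ext; rfl
    have hmapR : ((algebraMap (integralClosure (𝓞 K) T₁) (integralClosure (𝓞 K) (W.xDivisionField 3)) RT :
        integralClosure (𝓞 K) (W.xDivisionField 3)) : W.xDivisionField 3) = ⟨R, mR⟩ := rfl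
    obtain ⟨e', he'⟩ : ∃ e' : ℕ, e' = @Ideal.ramificationIdx' _ _ _ _ algT
        (@Ideal.under _ _ _ _ algT (𝔓.comap ((W.xDivisionField 3).integralClosureToAbsIntegers (𝓞 K))))
        (𝔓.comap ((W.xDivisionField 3).integralClosureToAbsIntegers (𝓞 K))) := ⟨_, rfl⟩
    have htr : ∀ X : integralClosure (𝓞 K) T₁,
        ord (𝔓.comap ((W.xDivisionField 3).integralClosureToAbsIntegers (𝓞 K)))
          (algebraMap (integralClosure (𝓞 K) T₁) (integralClosure (𝓞 K) (W.xDivisionField 3)) X) =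
        e' * ord (@Ideal.under _ _ _ _ algT (𝔓.comap ((W.xDivisionField 3).integralClosureToAbsIntegers (𝓞 K)))) X := by
      intro X
      rw [he']
      exact ord_algebraMap_integralClosure (𝓞 K) T₁ (K := K) (L := W.xDivisionField 3) _ hPE0 X
    -- `e' = #Q₁`
    have he'card : e' = Nat.card Q1 := by
      have h := ramificationIdx'_under_eq_card_inertia (𝓞 K) T₁ (K := K) (L := W.xDivisionField 3) _ hPE0
      rw [← he'] at h
      rw [h]
      -- every element of `T₁.fixingSubgroup = Q₁` lies in the inertia group
      have htop : (𝔓.comap ((W.xDivisionField 3).integralClosureToAbsIntegers (𝓞 K))).inertia T₁.fixingSubgroup = ⊤ := by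
        rw [eq_top_iff]
        intro x _
        rw [← Ideal.ramificationSubgroup_zero, mem_ramificationSubgroup_subgroup_iff, Ideal.ramificationSubgroup_zero]
        have hx : (x : W.xDivisionField 3 ≃ₐ[K] W.xDivisionField 3) ∈ Q1 := by rw [← hfixT]; exact x.2
        have := hQ10 _ hx
        rwa [Ideal.ramificationSubgroup_zero] at this
      rw [htop, Subgroup.card_top, hfixT]
    have he'pos : 0 < e' := by rw [he'card]; exact Nat.card_pos
    have he'0 : (e' : ℕ∞) ≠ 0 := by exact_mod_cast he'pos.ne'
    -- `#Q₀ = e' · v_T(π_T)` with `v_T(π_T)` odd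
    have hπT' : ((Nat.card ((𝔓.comap ((W.xDivisionField 3).integralClosureToAbsIntegers (𝓞 K))).ramificationSubgroup
        (W.xDivisionField 3 ≃ₐ[K] W.xDivisionField 3) 0) : ℕ) : ℕ∞) =
        e' * ord (@Ideal.under _ _ _ _ algT (𝔓.comap ((W.xDivisionField 3).integralClosureToAbsIntegers (𝓞 K)))) πT := by
      rw [← hordπ, ← hmapπ, htr]
    have hfinπ : ord (@Ideal.under _ _ _ _ algT (𝔓.comap ((W.xDivisionField 3).integralClosureToAbsIntegers (𝓞 K)))) πT ≠ ⊤ := by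
      intro h
      rw [h, ENat.mul_top he'0] at hπT'
      exact ENat.coe_ne_top _ hπT'
    obtain ⟨eT, heT⟩ := ENat.ne_top_iff_exists.mp hfinπ
    have hmul : Nat.card ((𝔓.comap ((W.xDivisionField 3).integralClosureToAbsIntegers (𝓞 K))).ramificationSubgroup
        (W.xDivisionField 3 ≃ₐ[K] W.xDivisionField 3) 0) = e' * eT := by
      rw [← heT] at hπT'
      exact_mod_cast hπT'
    set a := (Nat.card ((𝔓.comap ((W.xDivisionField 3).integralClosureToAbsIntegers (𝓞 K))).ramificationSubgroup
      (W.xDivisionField 3 ≃ₐ[K] W.xDivisionField 3) 0)).factorization 2 with ha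
    have heTodd : Odd eT := by
      rw [Nat.odd_iff]
      by_contra hne
      have h2 : 2 ∣ eT := Nat.dvd_of_mod_eq_zero (by omega)
      obtain ⟨m, hm⟩ := h2
      have hN0 : Nat.card ((𝔓.comap ((W.xDivisionField 3).integralClosureToAbsIntegers (𝓞 K))).ramificationSubgroup
          (W.xDivisionField 3 ≃ₐ[K] W.xDivisionField 3) 0) ≠ 0 := Nat.card_pos.ne'
      have hdvd : 2 ^ (a + 1) ∣ Nat.card ((𝔓.comap ((W.xDivisionField 3).integralClosureToAbsIntegers (𝓞 K))).ramificationSubgroup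
          (W.xDivisionField 3 ≃ₐ[K] W.xDivisionField 3) 0) :=
        ⟨m, by rw [hmul, he'card, hcardpow, hm]; ring⟩
      have := (Nat.Prime.pow_dvd_iff_le_factorization Nat.prime_two hN0).mp hdvd
      omega
    -- transfer of `ht` and `hle` to `T₁`
    have htA : ord (𝔓.comap ((W.xDivisionField 3).integralClosureToAbsIntegers (𝓞 K))) (A - s ^ 2) =
        e' * ord (@Ideal.under _ _ _ _ algT (𝔓.comap ((W.xDivisionField 3).integralClosureToAbsIntegers (𝓞 K)))) (AT - sT ^ 2) := by
      rw [← hmapA, ← hmaps, ← map_pow, ← map_sub, htr]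
    have ht2s : ord (𝔓.comap ((W.xDivisionField 3).integralClosureToAbsIntegers (𝓞 K))) (2 * s) =
        e' * ord (@Ideal.under _ _ _ _ algT (𝔓.comap ((W.xDivisionField 3).integralClosureToAbsIntegers (𝓞 K)))) (2 * sT) := by
      rw [show (2 : integralClosure (𝓞 K) (W.xDivisionField 3)) * s =
        algebraMap (integralClosure (𝓞 K) T₁) (integralClosure (𝓞 K) (W.xDivisionField 3)) (2 * sT) by
          rw [map_mul, map_ofNat, hmaps], htr]
    have he₀0 : (e₀ : ℕ∞) ≠ 0 := by
      obtain ⟨k, hk⟩ := he₀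
      exact_mod_cast (show e₀ ≠ 0 by omega)
    have hfinA : ord (@Ideal.under _ _ _ _ algT (𝔓.comap ((W.xDivisionField 3).integralClosureToAbsIntegers (𝓞 K)))) (AT - sT ^ 2) ≠ ⊤ := by
      intro h
      rw [htA, h, ENat.mul_top he'0, ENat.mul_top he₀0, hordπ, ← Nat.cast_mul] at ht
      exact ENat.top_ne_coe _ ht
    obtain ⟨u, hu⟩ := ENat.ne_top_iff_exists.mp hfinA
    have hkey : e₀ * (e' * u) = t * Nat.card ((𝔓.comap ((W.xDivisionField 3).integralClosureToAbsIntegers (𝓞 K))).ramificationSubgroup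
        (W.xDivisionField 3 ≃ₐ[K] W.xDivisionField 3) 0) := by
      rw [htA, ← hu, hordπ] at ht
      exact_mod_cast ht
    have hkey' : e₀ * u = t * eT := by
      apply Nat.eq_of_mul_eq_mul_left he'pos
      calc e' * (e₀ * u) = e₀ * (e' * u) := by ring
        _ = t * (e' * eT) := by rw [hkey, hmul]
        _ = e' * (t * eT) := by ring
    -- `2 v_T(R_T - s_T) = u`
    haveI := integralClosure_isIntegral (𝓞 K) T₁ (K := K) (L := W.xDivisionField 3)
    have hPT0 : (@Ideal.under _ _ _ _ algT (𝔓.comap ((W.xDivisionField 3).integralClosureToAbsIntegers (𝓞 K)))) ≠ ⊥ :=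
      Ideal.IsIntegral.comap_ne_bot _ hPE0
    haveI hPTmax := isMaximal_under_integralClosure (𝓞 K) T₁ (𝔓.comap ((W.xDivisionField 3).integralClosureToAbsIntegers (𝓞 K)))
    have hsqT : RT ^ 2 = AT := by
      apply Subtype.ext; apply Subtype.ext; apply Subtype.ext
      push_cast
      exact hAR.symm
    have hleT : (u : ℕ∞) ≤ 2 * ord (@Ideal.under _ _ _ _ algT (𝔓.comap ((W.xDivisionField 3).integralClosureToAbsIntegers (𝓞 K)))) (2 * sT) := by
      rw [htA, ht2s, ← hu] at hle
      generalize hb : ord (@Ideal.under _ _ _ _ algT (𝔓.comap ((W.xDivisionField 3).integralClosureToAbsIntegers (𝓞 K)))) (2 * sT) = b at hle ⊢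
      induction b using ENat.recTopCoe with
      | top => rw [ENat.mul_top (by norm_num)]; exact le_top
      | coe b =>
        have h' : e' * u ≤ 2 * (e' * b) := by exact_mod_cast hle
        have : u ≤ 2 * b := by nlinarith
        exact_mod_cast this
    have h2u : 2 * ord (@Ideal.under _ _ _ _ algT (𝔓.comap ((W.xDivisionField 3).integralClosureToAbsIntegers (𝓞 K)))) (RT - sT) = u :=
      two_mul_ord_sub_eq_of_le _ hPT0 (by rw [hsqT, ← hu]) hleT
    have hfinR : ord (@Ideal.under _ _ _ _ algT (𝔓.comap ((W.xDivisionField 3).integralClosureToAbsIntegers (𝓞 K)))) (RT - sT) ≠ ⊤ := by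
      intro h
      rw [h, ENat.mul_top (by norm_num)] at h2u
      exact ENat.top_ne_coe _ h2u
    obtain ⟨w, hw⟩ := ENat.ne_top_iff_exists.mp hfinR
    have h2w : 2 * w = u := by
      rw [← hw] at h2u
      exact_mod_cast h2u
    -- parity
    have hodd : Odd (e₀ * u) := by rw [hkey']; exact hto.mul heTodd
    have heven : Even (e₀ * u) := ⟨e₀ * w, by rw [← h2w]; ring⟩
    exact (Nat.not_even_iff_odd.mpr hodd) heven
  -- values of `A_k` are fixed by lifts of `Q₁`
  have hnumσ : ∀ (σ : absoluteGaloisGroup K) (m : ℕ), σ • ((m : AlgebraicClosure K)) = m := fun σ m ↦ by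
    rw [show ((m : AlgebraicClosure K)) = algebraMap K (AlgebraicClosure K) m from (map_natCast _ m).symm]
    exact smul_algebraMap σ (m : K)
  have hfixA : ∀ (A : integralClosure (𝓞 K) (W.xDivisionField 3)) (k : ℕ),
      ((A : W.xDivisionField 3) : AlgebraicClosure K) = algebraMap K (AlgebraicClosure K) W.c₄ - 12 * ζ ^ k * δ →
      ∀ g, g ∈ Q1 → ∀ σ : absoluteGaloisGroup K, absRestrictNormalHom (W.xDivisionField 3) σ = g →
        σ • ((A : W.xDivisionField 3) : AlgebraicClosure K) = ((A : W.xDivisionField 3) : AlgebraicClosure K) := by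
    intro A k hA g hg σ hσ
    obtain ⟨fζ, fδ⟩ := hliftfix g hg σ hσ
    have e12 := hnumσ σ 12
    push_cast at e12
    rw [hA, smul_sub, smul_mul', smul_mul', smul_pow', smul_algebraMap, e12, fζ, fδ]
  have hA₀' : ((A₀ : W.xDivisionField 3) : AlgebraicClosure K) = algebraMap K (AlgebraicClosure K) W.c₄ - 12 * ζ ^ 0 * δ := by
    rw [hA₀, pow_zero, mul_one]
  have hA₁' : ((A₁ : W.xDivisionField 3) : AlgebraicClosure K) = algebraMap K (AlgebraicClosure K) W.c₄ - 12 * ζ ^ 1 * δ := by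
    rw [hA₁, pow_one]
  have hfixs : ∀ (s : integralClosure (𝓞 K) (W.xDivisionField 3)),
      (∀ σ : absoluteGaloisGroup K, σ • ζ = ζ → σ • δ = δ →
        σ • ((s : W.xDivisionField 3) : AlgebraicClosure K) = ((s : W.xDivisionField 3) : AlgebraicClosure K)) →
      ∀ g, g ∈ Q1 → ∀ σ : absoluteGaloisGroup K, absRestrictNormalHom (W.xDivisionField 3) σ = g →
        σ • ((s : W.xDivisionField 3) : AlgebraicClosure K) = ((s : W.xDivisionField 3) : AlgebraicClosure K) := by
    intro s hs g hg σ hσ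
    obtain ⟨fζ, fδ⟩ := hliftfix g hg σ hσ
    exact hs σ fζ fδ
  -- lifts of the same `g` agree on `E`
  have hlifts : ∀ (g : W.xDivisionField 3 ≃ₐ[K] W.xDivisionField 3) (σ σ' : absoluteGaloisGroup K),
      absRestrictNormalHom (W.xDivisionField 3) σ = g → absRestrictNormalHom (W.xDivisionField 3) σ' = g →
      ∀ (R : AlgebraicClosure K), R ∈ W.xDivisionField 3 → σ • R = σ' • R := by
    intro g σ σ' hσ hσ' R hR
    rw [← hresf g σ hσ ⟨R, hR⟩, ← hresf g σ' hσ' ⟨R, hR⟩]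
  have hone_fix : ∀ (σ : absoluteGaloisGroup K), absRestrictNormalHom (W.xDivisionField 3) σ = 1 →
      ∀ (R : AlgebraicClosure K), R ∈ W.xDivisionField 3 → σ • R = R := by
    intro σ hσ R hR
    rw [← hresf 1 σ hσ ⟨R, hR⟩, AlgEquiv.one_apply]
  -- `#Q₁ ∈ {1, 2, 4}`; exclude `1` and `2`
  set a := (Nat.card ((𝔓.comap ((W.xDivisionField 3).integralClosureToAbsIntegers (𝓞 K))).ramificationSubgroup
    (W.xDivisionField 3 ≃ₐ[K] W.xDivisionField 3) 0)).factorization 2 with ha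
  by_contra hne4
  have ha1 : a ≤ 1 := by
    by_contra h
    have h2 : 2 ≤ a := by omega
    have h4 : 4 ≤ Nat.card Q1 := by
      rw [hcardpow]
      calc 4 = 2 ^ 2 := by norm_num
        _ ≤ 2 ^ a := Nat.pow_le_pow_right two_pos h2
    exact hne4 (le_antisymm hle4 h4)
  interval_cases a
  · -- `#Q₁ = 1`: `Q₁ = 1` fixes `R₀`
    rw [pow_zero] at hcardpow
    have hbot : Q1 = ⊥ := Subgroup.card_eq_one.mp hcardpow
    refine core R₀ mR₀ A₀ s₀ t₀ (by rw [hA₀, h₀]) ?_ (hfixA A₀ 0 hA₀') (hfixs s₀ hs₀) hto₀ ht₀ hle₀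
    intro g hg σ hσ
    rw [hbot, Subgroup.mem_bot] at hg
    rw [hg] at hσ
    exact hone_fix σ hσ R₀ mR₀
  · -- `#Q₁ = 2`: `Q₁ = {1, τ}` with `τ` an even sign change `≠ 1`, fixing exactly one `R_k`
    rw [pow_one] at hcardpow
    obtain ⟨τ, hτ1, hτu⟩ := (Nat.card_eq_two_iff' (1 : Q1)).mp hcardpow
    obtain ⟨στ, hστ⟩ := absRestrictNormalHom_surjective' (W.xDivisionField 3) (τ : W.xDivisionField 3 ≃ₐ[K] W.xDivisionField 3)
    obtain ⟨fζ, fδ⟩ := hliftfix _ τ.2 στ hστ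
    obtain ⟨s0, s1, s2⟩ := W.smul_radical_eq_or_eq_neg h₀ h₁ h₂ fζ fδ
    -- every `g ∈ Q₁` is `1` or `τ`
    have hcases : ∀ g, g ∈ Q1 → g = 1 ∨ g = (τ : W.xDivisionField 3 ≃ₐ[K] W.xDivisionField 3) := by
      intro g hg
      by_cases h1 : (⟨g, hg⟩ : Q1) = 1
      · exact Or.inl (congrArg Subtype.val h1)
      · exact Or.inr (congrArg Subtype.val (hτu ⟨g, hg⟩ h1))
    have hfix_of : ∀ (R : AlgebraicClosure K), R ∈ W.xDivisionField 3 → στ • R = R →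
        ∀ g, g ∈ Q1 → ∀ σ : absoluteGaloisGroup K, absRestrictNormalHom (W.xDivisionField 3) σ = g → σ • R = R := by
      intro R hR hτR g hg σ hσ
      rcases hcases g hg with h | h
      · rw [h] at hσ
        exact hone_fix σ hσ R hR
      · rw [h] at hσ
        rw [hlifts _ σ στ hσ hστ R hR]
        exact hτR
    -- `τ ≠ 1` as an automorphism
    have hτne : (τ : W.xDivisionField 3 ≃ₐ[K] W.xDivisionField 3) ≠ 1 := fun h => hτ1 (Subtype.ext h)
    have h2' : (2 : AlgebraicClosure K) ≠ 0 := two_ne_zero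
    have hprodne : R₀ * R₁ * R₂ ≠ 0 := mul_ne_zero (mul_ne_zero hRne.1 hRne.2.1) hRne.2.2
    have hρτ := hρσ στ
    rcases s0 with e0 | e0 <;> rcases s1 with e1 | e1 <;> rcases s2 with e2 | e2 <;>
      rw [e0, e1, e2] at hρτ
    · -- (+,+,+): `τ = 1`
      exact hτne (W.algEquiv_xDivisionField_three_eq_of_smul_radical_eq hζ hδ h₀ h₁ h₂ hρ hc₆ hστ (map_one _)
        (by rw [e0, one_smul]) (by rw [e1, one_smul]))
    · exact hprodne (by linear_combination (-(1 / 2) : AlgebraicClosure K) * hρτ)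
    · exact hprodne (by linear_combination (-(1 / 2) : AlgebraicClosure K) * hρτ)
    · -- (+,-,-): `k = 0`
      exact core R₀ mR₀ A₀ s₀ t₀ (by rw [hA₀, h₀]) (hfix_of R₀ mR₀ e0) (hfixA A₀ 0 hA₀') (hfixs s₀ hs₀) hto₀ ht₀ hle₀
    · exact hprodne (by linear_combination (-(1 / 2) : AlgebraicClosure K) * hρτ)
    · -- (-,+,-): `k = 1`
      exact core R₁ mR₁ A₁ s₁ t₁ (by rw [hA₁, h₁]) (hfix_of R₁ mR₁ e1) (hfixA A₁ 1 hA₁') (hfixs s₁ hs₁) hto₁ ht₁ hle₁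
    · -- (-,-,+): `k = 2`
      exact core R₂ mR₂ A₂ s₂ t₂ (by rw [hA₂, h₂]) (hfix_of R₂ mR₂ e2) (hfixA A₂ 2 hA₂) (hfixs s₂ hs₂) hto₂ ht₂ hle₂
    · exact hprodne (by linear_combination (-(1 / 2) : AlgebraicClosure K) * hρτ)

set_option maxHeartbeats 800000 in
set_option synthInstance.maxHeartbeats 400000 in
/-- **`#Q₀(𝔓 ∩ K(x(E[3]))) = 4` when `∛Δ` is a `v`-unit up to `K`.**  In the setting of
`card_ramificationSubgroup_one_xDivisionField_three_eq_four` (with `#Q₁ = 4`), if `δ = δ₁ · d` with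
`d ∈ 𝓞_K ∖ 0` and `δ₁ ∈ S_E ∖ 𝔓_E`, then the inertia group of `𝔓 ∩ E` has order `4`: an inertia
element `g` has `gδ₁ ≡ δ₁ (mod 𝔓_E)`, and `gδ = ζ^iδ` with `i ≠ 0` would give `(ζ - 1)δ₁ ∈ 𝔓_E` or
`(ζ² - 1)δ₁ ∈ 𝔓_E`, impossible (`(ζ - 1)² = -3ζ`, `(ζ + 1)² = ζ` are units); so `Q₀` fixes `ζ, δ`,
embeds in `{±1}²`, and `4 = #Q₁ ∣ #Q₀ ≤ 4`.
Ref: Serre, *Local Fields*, Ch. I §7 Prop. 20–22. [cite: SerreLocalFields1979, Ch. I §7 Prop. 20] -/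
theorem card_inertia_xDivisionField_three_eq_four [W.IsElliptic]
    {v : HeightOneSpectrum (𝓞 K)} (h3 : ((3 : ℕ) : 𝓞 K) ∉ v.asIdeal)
    {𝔓 : Ideal (absIntegers (𝓞 K) K)} (h𝔓 : 𝔓 ∈ v.primesAbove)
    {ζ δ R₀ R₁ R₂ : AlgebraicClosure K} (hζ : ζ ^ 2 + ζ + 1 = 0)
    (hδ : δ ^ 3 = algebraMap K (AlgebraicClosure K) W.Δ)
    (h₀ : R₀ ^ 2 = algebraMap K (AlgebraicClosure K) W.c₄ - 12 * δ)
    (h₁ : R₁ ^ 2 = algebraMap K (AlgebraicClosure K) W.c₄ - 12 * ζ * δ)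
    (h₂ : R₂ ^ 2 = algebraMap K (AlgebraicClosure K) W.c₄ - 12 * ζ ^ 2 * δ)
    (hρ : R₀ * R₁ * R₂ = algebraMap K (AlgebraicClosure K) W.c₆) (hc₆ : W.c₆ ≠ 0)
    (hcard : Nat.card ((𝔓.comap ((W.xDivisionField 3).integralClosureToAbsIntegers (𝓞 K))).ramificationSubgroup
      (W.xDivisionField 3 ≃ₐ[K] W.xDivisionField 3) 1) = 4)
    {δ₁ : integralClosure (𝓞 K) (W.xDivisionField 3)} {d : 𝓞 K} (hd : d ≠ 0)
    (hδ₁ : ((δ₁ : W.xDivisionField 3) : AlgebraicClosure K) * algebraMap K (AlgebraicClosure K) (algebraMap (𝓞 K) K d) = δ)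
    (hδ₁u : δ₁ ∉ 𝔓.comap ((W.xDivisionField 3).integralClosureToAbsIntegers (𝓞 K))) :
    Nat.card ((𝔓.comap ((W.xDivisionField 3).integralClosureToAbsIntegers (𝓞 K))).ramificationSubgroup
      (W.xDivisionField 3 ≃ₐ[K] W.xDivisionField 3) 0) = 4 := by
  classical
  haveI : Fact (Nat.Prime 3) := ⟨Nat.prime_three⟩
  have h2K : (2 : K) ≠ 0 := two_ne_zero
  have h3K : (3 : K) ≠ 0 := three_ne_zero
  haveI : 𝔓.IsPrime := h𝔓.1
  haveI h𝔓max : 𝔓.IsMaximal := HeightOneSpectrum.isMaximal_of_mem_primesAbove h𝔓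
  haveI : IsGalois K (W.xDivisionField 3) := {}
  haveI hPEmax : (𝔓.comap ((W.xDivisionField 3).integralClosureToAbsIntegers (𝓞 K))).IsMaximal :=
    isMaximal_comap_integralClosureToAbsIntegers (𝓞 K) 𝔓 (W.xDivisionField 3)
  have hunderE : (𝔓.comap ((W.xDivisionField 3).integralClosureToAbsIntegers (𝓞 K))).under (𝓞 K) = v.asIdeal := by
    rw [under_comap_integralClosureToAbsIntegers, ← h𝔓.2.over]
  have h3E : (3 : integralClosure (𝓞 K) (W.xDivisionField 3)) ∉
      𝔓.comap ((W.xDivisionField 3).integralClosureToAbsIntegers (𝓞 K)) := by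
    intro hmem
    apply h3
    rw [← hunderE, Ideal.under_def, Ideal.mem_comap, map_natCast]
    exact_mod_cast hmem
  obtain ⟨mR₀, mR₁, mR₂⟩ := W.radical_mem_xDivisionField_three h2K h3K hζ hδ h₀ h₁ h₂ hρ
  obtain ⟨mζ, mδ⟩ := W.zeta_mem_and_delta_mem_xDivisionField_three h2K h3K hζ hδ h₀ h₁ h₂ hρ
  have hδ0 : δ ≠ 0 := by
    intro h0
    rw [h0, zero_pow three_ne_zero] at hδ
    exact W.isUnit_Δ.ne_zero ((_root_.map_eq_zero_iff _ (algebraMap K (AlgebraicClosure K)).injective).mp hδ.symm)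
  have hζ3 : ζ ^ 3 = 1 := by linear_combination (ζ - 1) * hζ
  have hres : ∀ (g : W.xDivisionField 3 ≃ₐ[K] W.xDivisionField 3) (σ : absoluteGaloisGroup K),
      absRestrictNormalHom (W.xDivisionField 3) σ = g →
      ∀ X : integralClosure (𝓞 K) (W.xDivisionField 3),
        (((g • X : integralClosure (𝓞 K) (W.xDivisionField 3)) : W.xDivisionField 3) : AlgebraicClosure K) =
          σ • ((X : W.xDivisionField 3) : AlgebraicClosure K) := by
    intro g σ hσ X
    rw [integralClosure.coe_smul, ← hσ]
    exact AlgEquiv.restrictNormal_commutes (absoluteGaloisGroup.toAlgEquiv K σ) (W.xDivisionField 3) X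
  have hresf : ∀ (g : W.xDivisionField 3 ≃ₐ[K] W.xDivisionField 3) (σ : absoluteGaloisGroup K),
      absRestrictNormalHom (W.xDivisionField 3) σ = g →
      ∀ e : W.xDivisionField 3, ((g e : W.xDivisionField 3) : AlgebraicClosure K) =
        σ • (e : AlgebraicClosure K) := by
    intro g σ hσ e
    rw [← hσ]
    exact AlgEquiv.restrictNormal_commutes (absoluteGaloisGroup.toAlgEquiv K σ) (W.xDivisionField 3) e
  have hinjE : ∀ {X Y : integralClosure (𝓞 K) (W.xDivisionField 3)},
      ((X : W.xDivisionField 3) : AlgebraicClosure K) = ((Y : W.xDivisionField 3) : AlgebraicClosure K) →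
        X = Y := fun h => Subtype.ext (Subtype.ext h)
  -- `ζE ∈ S_E`
  have hζmem3 : (⟨ζ, mζ⟩ : W.xDivisionField 3) ^ 3 = 1 := Subtype.ext (by push_cast; exact hζ3)
  have hζint : _root_.IsIntegral (𝓞 K) (⟨ζ, mζ⟩ : W.xDivisionField 3) :=
    IsIntegral.of_pow three_pos (by rw [hζmem3]; exact isIntegral_one)
  set ζE : integralClosure (𝓞 K) (W.xDivisionField 3) := ⟨⟨ζ, mζ⟩, hζint⟩ with hζEdef
  have hζE : ζE ^ 2 + ζE + 1 = 0 := hinjE (by push_cast; exact hζ)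
  have hζE3 : ζE ^ 3 = 1 := by linear_combination (ζE - 1) * hζE
  -- `ζE - 1 ∉ 𝔓_E` and `ζE + 1 ∉ 𝔓_E`
  have hζunit : ζE ∉ 𝔓.comap ((W.xDivisionField 3).integralClosureToAbsIntegers (𝓞 K)) := by
    intro h
    have h1 : (1 : integralClosure (𝓞 K) (W.xDivisionField 3)) ∈ 𝔓.comap ((W.xDivisionField 3).integralClosureToAbsIntegers (𝓞 K)) := by
      rw [← hζE3, pow_succ]
      exact Ideal.mul_mem_left _ _ h
    exact hPEmax.ne_top ((Ideal.eq_top_iff_one _).mpr h1)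
  have hζm1 : ζE - 1 ∉ 𝔓.comap ((W.xDivisionField 3).integralClosureToAbsIntegers (𝓞 K)) := by
    intro h
    have hsq : (ζE - 1) * (ζE - 1) = -(3 * ζE) := by linear_combination hζE
    have h3ζ : 3 * ζE ∈ 𝔓.comap ((W.xDivisionField 3).integralClosureToAbsIntegers (𝓞 K)) := by
      have := Ideal.mul_mem_left _ (ζE - 1) h
      rw [hsq] at this
      exact (neg_mem_iff).mp this
    rcases (Ideal.IsPrime.mem_or_mem inferInstance h3ζ) with h' | h'
    · exact h3E h'
    · exact hζunit h'
  have hζp1 : ζE + 1 ∉ 𝔓.comap ((W.xDivisionField 3).integralClosureToAbsIntegers (𝓞 K)) := by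
    intro h
    have hsq : (ζE + 1) * (ζE + 1) = ζE := by linear_combination hζE
    have := Ideal.mul_mem_left _ (ζE + 1) h
    rw [hsq] at this
    exact hζunit this
  -- every `g ∈ Q₀` (lift `σ`) fixes `ζ` and `δ`
  have hd' : algebraMap (𝓞 K) (integralClosure (𝓞 K) (W.xDivisionField 3)) d ≠ 0 := by
    intro h0
    exact hd ((faithfulSMul_iff_algebraMap_injective _ _).mp
      (faithfulSMul_integralClosure (𝓞 K) (K := K) (L := (W.xDivisionField 3))) (h0.trans (map_zero _).symm))
  have hdval : ((algebraMap (𝓞 K) (integralClosure (𝓞 K) (W.xDivisionField 3)) d : W.xDivisionField 3) :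
      AlgebraicClosure K) = algebraMap K (AlgebraicClosure K) (algebraMap (𝓞 K) K d) := rfl
  have hfix0 : ∀ g, g ∈ (𝔓.comap ((W.xDivisionField 3).integralClosureToAbsIntegers (𝓞 K))).ramificationSubgroup
      (W.xDivisionField 3 ≃ₐ[K] W.xDivisionField 3) 0 → ∀ σ : absoluteGaloisGroup K,
      absRestrictNormalHom (W.xDivisionField 3) σ = g → σ • ζ = ζ ∧ σ • δ = δ := by
    intro g hg σ hσ
    have hσζ := W.smul_zeta_eq_of_mem_inertia_xDivisionField_three h3 h𝔓 hζ hδ h₀ h₁ h₂ hρ hg σ hσ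
    refine ⟨hσζ, ?_⟩
    -- cube-root trichotomy for `σ δ`
    have hcube : (σ • δ) ^ 3 = δ ^ 3 := by rw [← smul_pow', hδ, smul_algebraMap]
    have hfac : (σ • δ - δ) * (σ • δ - ζ * δ) * (σ • δ - ζ ^ 2 * δ) = 0 := by
      linear_combination hcube + (-(δ * (σ • δ) ^ 2) + ζ * δ ^ 2 * (σ • δ) - (ζ - 1) * δ ^ 3) * hζ
    -- `σ δ₁ = ζ^i δ₁` in `S_E`, and `σ δ₁ - δ₁ ∈ 𝔓_E`
    have hmem := (Ideal.mem_ramificationSubgroup_iff.mp hg).2 δ₁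
    rw [zero_add, pow_one] at hmem
    have hgδ₁val : (((g • δ₁ : integralClosure (𝓞 K) (W.xDivisionField 3)) : W.xDivisionField 3) : AlgebraicClosure K) *
        algebraMap K (AlgebraicClosure K) (algebraMap (𝓞 K) K d) = σ • δ := by
      rw [hres g σ hσ, ← hδ₁, smul_mul', smul_algebraMap]
    have key : ∀ i : ℕ, σ • δ = ζ ^ i * δ → g • δ₁ = ζE ^ i * δ₁ := by
      intro i hi
      have h1 : (g • δ₁ - ζE ^ i * δ₁) * algebraMap (𝓞 K) _ d = 0 := by
        apply hinjE
        push_cast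
        rw [show ((algebraMap (𝓞 K) (W.xDivisionField 3) d : W.xDivisionField 3) : AlgebraicClosure K) =
          algebraMap K (AlgebraicClosure K) (algebraMap (𝓞 K) K d) from rfl, sub_mul, hgδ₁val, hi, mul_assoc,
          show ((ζE : W.xDivisionField 3) : AlgebraicClosure K) = ζ from rfl, hδ₁]
        ring
      rcases mul_eq_zero.mp h1 with h | h
      · exact sub_eq_zero.mp h
      · exact absurd h hd'
    rcases mul_eq_zero.mp hfac with h12 | h3c
    · rcases mul_eq_zero.mp h12 with h1 | h2c
      · exact sub_eq_zero.mp h1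
      · exfalso
        have hg1 := key 1 (by rw [pow_one]; exact sub_eq_zero.mp h2c)
        rw [pow_one] at hg1
        rw [hg1, show ζE * δ₁ - δ₁ = (ζE - 1) * δ₁ by ring] at hmem
        rcases (Ideal.IsPrime.mem_or_mem inferInstance hmem) with h' | h'
        · exact hζm1 h'
        · exact hδ₁u h'
    · exfalso
      have hg2 := key 2 (sub_eq_zero.mp h3c)
      rw [hg2, show ζE ^ 2 * δ₁ - δ₁ = (ζE - 1) * ((ζE + 1) * δ₁) by ring] at hmem
      rcases (Ideal.IsPrime.mem_or_mem inferInstance hmem) with h' | h'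
      · exact hζm1 h'
      · rcases (Ideal.IsPrime.mem_or_mem inferInstance h') with h'' | h''
        · exact hζp1 h''
        · exact hδ₁u h''
  -- the sign map `Q₀ → {±1}²` is injective, so `#Q₀ ≤ 4`; and `4 = #Q₁ ∣ #Q₀`
  obtain ⟨Q0, hQ0⟩ : ∃ Q0 : Subgroup (W.xDivisionField 3 ≃ₐ[K] W.xDivisionField 3),
      Q0 = (𝔓.comap ((W.xDivisionField 3).integralClosureToAbsIntegers (𝓞 K))).ramificationSubgroup
        (W.xDivisionField 3 ≃ₐ[K] W.xDivisionField 3) 0 := ⟨_, rfl⟩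
  rw [← hQ0]
  have hmem0 : ∀ g, g ∈ Q0 → g ∈ (𝔓.comap ((W.xDivisionField 3).integralClosureToAbsIntegers (𝓞 K))).ramificationSubgroup
      (W.xDivisionField 3 ≃ₐ[K] W.xDivisionField 3) 0 := fun g hg => hQ0 ▸ hg
  have hval : ∀ (g : W.xDivisionField 3 ≃ₐ[K] W.xDivisionField 3) (σ : absoluteGaloisGroup K),
      absRestrictNormalHom (W.xDivisionField 3) σ = g → ∀ (R : AlgebraicClosure K) (hR : R ∈ W.xDivisionField 3),
      (g ⟨R, hR⟩ = ⟨R, hR⟩ ↔ σ • R = R) := by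
    intro g σ hσ R hR
    rw [Subtype.ext_iff, hresf g σ hσ]
  let f : Q0 → Bool × Bool := fun g =>
    (decide ((g : W.xDivisionField 3 ≃ₐ[K] W.xDivisionField 3) ⟨R₀, mR₀⟩ = ⟨R₀, mR₀⟩),
     decide ((g : W.xDivisionField 3 ≃ₐ[K] W.xDivisionField 3) ⟨R₁, mR₁⟩ = ⟨R₁, mR₁⟩))
  have hf_inj : Function.Injective f := by
    rintro ⟨g, hg⟩ ⟨g', hg'⟩ hgg'
    simp only [f, Prod.mk.injEq, decide_eq_decide] at hgg'
    obtain ⟨e0, e1⟩ := hgg'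
    obtain ⟨σ, hσ⟩ := absRestrictNormalHom_surjective' (W.xDivisionField 3) g
    obtain ⟨σ', hσ'⟩ := absRestrictNormalHom_surjective' (W.xDivisionField 3) g'
    obtain ⟨fζ, fδ⟩ := hfix0 g (hmem0 g hg) σ hσ
    obtain ⟨fζ', fδ'⟩ := hfix0 g' (hmem0 g' hg') σ' hσ'
    obtain ⟨s0, s1, -⟩ := W.smul_radical_eq_or_eq_neg h₀ h₁ h₂ fζ fδ
    obtain ⟨s0', s1', -⟩ := W.smul_radical_eq_or_eq_neg h₀ h₁ h₂ fζ' fδ'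
    rw [hval g σ hσ, hval g' σ' hσ'] at e0 e1
    have a0 : σ • R₀ = σ' • R₀ := by
      rcases s0 with h | h
      · rw [h, e0.mp h]
      · rcases s0' with h' | h'
        · rw [h', e0.mpr h']
        · rw [h, h']
    have a1 : σ • R₁ = σ' • R₁ := by
      rcases s1 with h | h
      · rw [h, e1.mp h]
      · rcases s1' with h' | h'
        · rw [h', e1.mpr h']
        · rw [h, h']
    exact Subtype.ext (W.algEquiv_xDivisionField_three_eq_of_smul_radical_eq hζ hδ h₀ h₁ h₂ hρ hc₆ hσ hσ' a0 a1)
  have hle4 : Nat.card Q0 ≤ 4 := by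
    have h := Nat.card_le_card_of_injective f hf_inj
    rwa [Nat.card_prod, show Nat.card Bool = 2 by simp] at h
  have hdvd : 4 ∣ Nat.card Q0 := by
    rw [← hcard, hQ0]
    exact Subgroup.card_dvd_of_le (Ideal.ramificationSubgroup_antitone _ _ (Nat.zero_le 1))
  have hpos : 0 < Nat.card Q0 := Nat.card_pos
  obtain ⟨m, hm⟩ := hdvd
  rcases Nat.eq_zero_or_pos m with h0 | hmpos
  · rw [hm, h0] at hpos; norm_num at hpos
  · nlinarith

set_option maxHeartbeats 1600000 in
set_option synthInstance.maxHeartbeats 400000 in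
/-- **`#Q₀(𝔓 ∩ K(x(E[3]))) = 12` when `3 ∤ v(Δ)`.**  In the setting of
`card_ramificationSubgroup_one_xDivisionField_three_eq_four` (with `#Q₁ = 4`), if `Δ = D ∈ 𝓞_K` with
`v_{𝔓_E}(D) = v_Δ · v_{𝔓_E}(π)`, `π ∈ v ∖ v²`, `3 ∤ v_Δ`, then the inertia group of `𝔓 ∩ E` has
order `12`: `3 v(∛Δ) = v_Δ · v(π) = v_Δ · #Q₀` gives `3 ∣ #Q₀`, `#Q₁ = 4 ∣ #Q₀`, and `Q₀` embeds in
`ℤ/3 × {±1}²` via `g ↦ (i, ε₀, ε₁)`, `gδ = ζ^iδ`, `gR₀ = ε₀R_i`, `gR₁ = ε₁R_{i+1}` (`g` fixes `ζ`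
and is determined by `gR₀, gR₁`).
Ref: Serre, *Local Fields*, Ch. I §7 Prop. 20–22 and Cor. to Prop. 21.
[cite: SerreLocalFields1979, Ch. I §7 Cor. to Prop. 21] -/
theorem card_inertia_xDivisionField_three_eq_twelve [W.IsElliptic]
    {v : HeightOneSpectrum (𝓞 K)} (hv2 : (2 : 𝓞 K) ∈ v.asIdeal) (h3 : ((3 : ℕ) : 𝓞 K) ∉ v.asIdeal)
    {𝔓 : Ideal (absIntegers (𝓞 K) K)} (h𝔓 : 𝔓 ∈ v.primesAbove)
    {ζ δ R₀ R₁ R₂ : AlgebraicClosure K} (hζ : ζ ^ 2 + ζ + 1 = 0)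
    (hδ : δ ^ 3 = algebraMap K (AlgebraicClosure K) W.Δ)
    (h₀ : R₀ ^ 2 = algebraMap K (AlgebraicClosure K) W.c₄ - 12 * δ)
    (h₁ : R₁ ^ 2 = algebraMap K (AlgebraicClosure K) W.c₄ - 12 * ζ * δ)
    (h₂ : R₂ ^ 2 = algebraMap K (AlgebraicClosure K) W.c₄ - 12 * ζ ^ 2 * δ)
    (hρ : R₀ * R₁ * R₂ = algebraMap K (AlgebraicClosure K) W.c₆) (hc₆ : W.c₆ ≠ 0)
    (hcard : Nat.card ((𝔓.comap ((W.xDivisionField 3).integralClosureToAbsIntegers (𝓞 K))).ramificationSubgroup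
      (W.xDivisionField 3 ≃ₐ[K] W.xDivisionField 3) 1) = 4)
    {π : 𝓞 K} (hπ : π ∈ v.asIdeal) (hπ2 : π ∉ v.asIdeal ^ 2)
    {D : 𝓞 K} (hD : algebraMap (𝓞 K) K D = W.Δ) {vD : ℕ} (h3vD : ¬ 3 ∣ vD)
    (hvD : ord (𝔓.comap ((W.xDivisionField 3).integralClosureToAbsIntegers (𝓞 K)))
        (algebraMap (𝓞 K) (integralClosure (𝓞 K) (W.xDivisionField 3)) D) =
      vD * ord (𝔓.comap ((W.xDivisionField 3).integralClosureToAbsIntegers (𝓞 K)))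
        (algebraMap (𝓞 K) (integralClosure (𝓞 K) (W.xDivisionField 3)) π)) :
    Nat.card ((𝔓.comap ((W.xDivisionField 3).integralClosureToAbsIntegers (𝓞 K))).ramificationSubgroup
      (W.xDivisionField 3 ≃ₐ[K] W.xDivisionField 3) 0) = 12 := by
  classical
  haveI : Fact (Nat.Prime 3) := ⟨Nat.prime_three⟩
  have h2K : (2 : K) ≠ 0 := two_ne_zero
  have h3K : (3 : K) ≠ 0 := three_ne_zero
  haveI hDDE : IsDedekindDomain (integralClosure (𝓞 K) (W.xDivisionField 3)) :=
    integralClosure.isDedekindDomain (𝓞 K) K (W.xDivisionField 3)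
  haveI : 𝔓.IsPrime := h𝔓.1
  haveI h𝔓max : 𝔓.IsMaximal := HeightOneSpectrum.isMaximal_of_mem_primesAbove h𝔓
  haveI : IsGalois K (W.xDivisionField 3) := {}
  haveI hPEmax : (𝔓.comap ((W.xDivisionField 3).integralClosureToAbsIntegers (𝓞 K))).IsMaximal :=
    isMaximal_comap_integralClosureToAbsIntegers (𝓞 K) 𝔓 (W.xDivisionField 3)
  have hunderE : (𝔓.comap ((W.xDivisionField 3).integralClosureToAbsIntegers (𝓞 K))).under (𝓞 K) = v.asIdeal := by
    rw [under_comap_integralClosureToAbsIntegers, ← h𝔓.2.over]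
  have hPE0 : (𝔓.comap ((W.xDivisionField 3).integralClosureToAbsIntegers (𝓞 K))) ≠ ⊥ := by
    intro h0
    have hinj : Function.Injective (algebraMap (𝓞 K) (integralClosure (𝓞 K) (W.xDivisionField 3))) :=
      (faithfulSMul_iff_algebraMap_injective _ _).mp
        (faithfulSMul_integralClosure (𝓞 K) (K := K) (L := (W.xDivisionField 3)))
    have h2' : (2 : 𝓞 K) ∈ (𝔓.comap ((W.xDivisionField 3).integralClosureToAbsIntegers (𝓞 K))).under (𝓞 K) := by
      rw [hunderE]; exact hv2
    rw [Ideal.under_def, Ideal.mem_comap, h0, Ideal.mem_bot] at h2'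
    exact two_ne_zero (hinj (h2'.trans (map_zero _).symm))
  obtain ⟨mR₀, mR₁, mR₂⟩ := W.radical_mem_xDivisionField_three h2K h3K hζ hδ h₀ h₁ h₂ hρ
  obtain ⟨mζ, mδ⟩ := W.zeta_mem_and_delta_mem_xDivisionField_three h2K h3K hζ hδ h₀ h₁ h₂ hρ
  have hδ0 : δ ≠ 0 := by
    intro h0
    rw [h0, zero_pow three_ne_zero] at hδ
    exact W.isUnit_Δ.ne_zero ((_root_.map_eq_zero_iff _ (algebraMap K (AlgebraicClosure K)).injective).mp hδ.symm)
  have hζ3 : ζ ^ 3 = 1 := by linear_combination (ζ - 1) * hζ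
  have hresf : ∀ (g : W.xDivisionField 3 ≃ₐ[K] W.xDivisionField 3) (σ : absoluteGaloisGroup K),
      absRestrictNormalHom (W.xDivisionField 3) σ = g →
      ∀ e : W.xDivisionField 3, ((g e : W.xDivisionField 3) : AlgebraicClosure K) =
        σ • (e : AlgebraicClosure K) := by
    intro g σ hσ e
    rw [← hσ]
    exact AlgEquiv.restrictNormal_commutes (absoluteGaloisGroup.toAlgEquiv K σ) (W.xDivisionField 3) e
  have hinjE : ∀ {X Y : integralClosure (𝓞 K) (W.xDivisionField 3)},
      ((X : W.xDivisionField 3) : AlgebraicClosure K) = ((Y : W.xDivisionField 3) : AlgebraicClosure K) →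
        X = Y := fun h => Subtype.ext (Subtype.ext h)
  -- (i) `3 ∣ #Q₀`: `3 v(δ) = v(Δ) = vD · v(π) = vD · #Q₀`
  have hordπ := ord_algebraMap_eq_card_inertia_of_mem_primesAbove h𝔓 (W.xDivisionField 3) hπ hπ2
  have hDval : ((algebraMap (𝓞 K) (W.xDivisionField 3) D : W.xDivisionField 3) : AlgebraicClosure K) =
      algebraMap K (AlgebraicClosure K) W.Δ := by
    rw [← hD]; rfl
  have hδmem3 : (⟨δ, mδ⟩ : W.xDivisionField 3) ^ 3 = algebraMap (𝓞 K) (W.xDivisionField 3) D :=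
    Subtype.ext (by push_cast; rw [hδ]; exact hDval.symm)
  have hδint : _root_.IsIntegral (𝓞 K) (⟨δ, mδ⟩ : W.xDivisionField 3) :=
    IsIntegral.of_pow three_pos (by rw [hδmem3]; exact isIntegral_algebraMap)
  set δE : integralClosure (𝓞 K) (W.xDivisionField 3) := ⟨⟨δ, mδ⟩, hδint⟩ with hδEdef
  have hδE3 : δE ^ 3 = algebraMap (𝓞 K) _ D := by
    apply hinjE
    push_cast
    rw [show ((δE : W.xDivisionField 3) : AlgebraicClosure K) = δ from rfl, hδ]
    exact hDval.symm
  have hδE0 : δE ≠ 0 := by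
    intro h0
    apply hδ0
    rw [← show ((δE : W.xDivisionField 3) : AlgebraicClosure K) = δ from rfl, h0]
    rfl
  have h3dvd : 3 ∣ Nat.card ((𝔓.comap ((W.xDivisionField 3).integralClosureToAbsIntegers (𝓞 K))).ramificationSubgroup
      (W.xDivisionField 3 ≃ₐ[K] W.xDivisionField 3) 0) := by
    obtain ⟨oδ, hoδ⟩ := exists_ord_eq_natCast _ hPE0 hδE0
    have h : (3 : ℕ∞) * oδ = vD * Nat.card ((𝔓.comap ((W.xDivisionField 3).integralClosureToAbsIntegers (𝓞 K))).ramificationSubgroup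
        (W.xDivisionField 3 ≃ₐ[K] W.xDivisionField 3) 0) := by
      rw [← hordπ, ← hvD, ← hδE3, ord_pow _ hPE0, hoδ]; norm_cast
    have h' : 3 * oδ = vD * Nat.card ((𝔓.comap ((W.xDivisionField 3).integralClosureToAbsIntegers (𝓞 K))).ramificationSubgroup
        (W.xDivisionField 3 ≃ₐ[K] W.xDivisionField 3) 0) := by exact_mod_cast h
    have h3 : 3 ∣ vD * Nat.card ((𝔓.comap ((W.xDivisionField 3).integralClosureToAbsIntegers (𝓞 K))).ramificationSubgroup
        (W.xDivisionField 3 ≃ₐ[K] W.xDivisionField 3) 0) := ⟨oδ, h'.symm⟩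
    exact ((Nat.Prime.dvd_mul Nat.prime_three).mp h3).resolve_left h3vD
  -- (ii) `4 ∣ #Q₀`
  have h4dvd : 4 ∣ Nat.card ((𝔓.comap ((W.xDivisionField 3).integralClosureToAbsIntegers (𝓞 K))).ramificationSubgroup
      (W.xDivisionField 3 ≃ₐ[K] W.xDivisionField 3) 0) := by
    rw [← hcard]
    exact Subgroup.card_dvd_of_le (Ideal.ramificationSubgroup_antitone _ _ (Nat.zero_le 1))
  have h12dvd : 12 ∣ Nat.card ((𝔓.comap ((W.xDivisionField 3).integralClosureToAbsIntegers (𝓞 K))).ramificationSubgroup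
      (W.xDivisionField 3 ≃ₐ[K] W.xDivisionField 3) 0) :=
    Nat.Coprime.mul_dvd_of_dvd_of_dvd (by norm_num : Nat.Coprime 3 4) h3dvd h4dvd
  -- (iii) `#Q₀ ≤ 12`: `g ↦ (i, sign of gR₀/R_i, sign of gR₁/R_{i+1})` is injective, `gδ = ζ^i δ`
  obtain ⟨Q0, hQ0⟩ : ∃ Q0 : Subgroup (W.xDivisionField 3 ≃ₐ[K] W.xDivisionField 3),
      Q0 = (𝔓.comap ((W.xDivisionField 3).integralClosureToAbsIntegers (𝓞 K))).ramificationSubgroup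
        (W.xDivisionField 3 ≃ₐ[K] W.xDivisionField 3) 0 := ⟨_, rfl⟩
  rw [← hQ0] at h12dvd ⊢
  have hmem0 : ∀ g, g ∈ Q0 → g ∈ (𝔓.comap ((W.xDivisionField 3).integralClosureToAbsIntegers (𝓞 K))).ramificationSubgroup
      (W.xDivisionField 3 ≃ₐ[K] W.xDivisionField 3) 0 := fun g hg => hQ0 ▸ hg
  set ζ' : W.xDivisionField 3 := ⟨ζ, mζ⟩ with hζ'
  set δ' : W.xDivisionField 3 := ⟨δ, mδ⟩ with hδ'
  set R₀' : W.xDivisionField 3 := ⟨R₀, mR₀⟩ with hR₀'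
  set R₁' : W.xDivisionField 3 := ⟨R₁, mR₁⟩ with hR₁'
  set R₂' : W.xDivisionField 3 := ⟨R₂, mR₂⟩ with hR₂'
  have hζ'rel : ζ' ^ 2 + ζ' + 1 = 0 := Subtype.ext (by push_cast; exact hζ)
  have hζ'3 : ζ' ^ 3 = 1 := by linear_combination (ζ' - 1) * hζ'rel
  have hδ'3 : δ' ^ 3 = algebraMap K (W.xDivisionField 3) W.Δ := Subtype.ext (by push_cast; exact hδ)
  have h₀' : R₀' ^ 2 = algebraMap K (W.xDivisionField 3) W.c₄ - 12 * δ' := Subtype.ext (by push_cast; exact h₀)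
  have h₁' : R₁' ^ 2 = algebraMap K (W.xDivisionField 3) W.c₄ - 12 * ζ' * δ' := Subtype.ext (by push_cast; exact h₁)
  have h₂' : R₂' ^ 2 = algebraMap K (W.xDivisionField 3) W.c₄ - 12 * ζ' ^ 2 * δ' := Subtype.ext (by push_cast; exact h₂)
  have hδ'0 : δ' ≠ 0 := fun h0 => hδ0 (by rw [← show ((δ' : W.xDivisionField 3) : AlgebraicClosure K) = δ from rfl, h0]; rfl)
  -- `g ∈ Q₀` fixes `ζ'`, and `gδ' ∈ {δ', ζ'δ', ζ'²δ'}`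
  have hgζ : ∀ g, g ∈ Q0 → g ζ' = ζ' := by
    intro g hg
    obtain ⟨σ, hσ⟩ := absRestrictNormalHom_surjective' (W.xDivisionField 3) g
    apply Subtype.ext
    rw [hresf g σ hσ]
    exact W.smul_zeta_eq_of_mem_inertia_xDivisionField_three h3 h𝔓 hζ hδ h₀ h₁ h₂ hρ (hmem0 g hg) σ hσ
  have htri : ∀ g, g ∈ Q0 → g δ' = δ' ∨ g δ' = ζ' * δ' ∨ g δ' = ζ' ^ 2 * δ' := by
    intro g hg
    have hcube : (g δ') ^ 3 = δ' ^ 3 := by rw [← map_pow, hδ'3, AlgEquiv.commutes]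
    have hfac : (g δ' - δ') * (g δ' - ζ' * δ') * (g δ' - ζ' ^ 2 * δ') = 0 := by
      linear_combination hcube + (-(δ' * (g δ') ^ 2) + ζ' * δ' ^ 2 * (g δ') - (ζ' - 1) * δ' ^ 3) * hζ'rel
    rcases mul_eq_zero.mp hfac with h12 | h3c
    · rcases mul_eq_zero.mp h12 with h1 | h2c
      · exact Or.inl (sub_eq_zero.mp h1)
      · exact Or.inr (Or.inl (sub_eq_zero.mp h2c))
    · exact Or.inr (Or.inr (sub_eq_zero.mp h3c))
  -- the index `i(g)` with `gδ' = ζ'^i δ'`, and the rotated radicals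
  have hζ1' : ζ' * δ' ≠ δ' := by
    intro h'
    have : (ζ' - 1) * δ' = 0 := by linear_combination h'
    rcases mul_eq_zero.mp this with h'' | h''
    · have hζ1 : ζ = 1 := congrArg (fun e : W.xDivisionField 3 => (e : AlgebraicClosure K)) (sub_eq_zero.mp h'')
      rw [hζ1] at hζ; norm_num at hζ
    · exact hδ'0 h''
  have hζ2' : ζ' ^ 2 * δ' ≠ δ' := by
    intro h'
    have : (ζ' - 1) * ((ζ' + 1) * δ') = 0 := by linear_combination h'
    rcases mul_eq_zero.mp this with h'' | h''
    · have hζ1 : ζ = 1 := congrArg (fun e : W.xDivisionField 3 => (e : AlgebraicClosure K)) (sub_eq_zero.mp h'')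
      rw [hζ1] at hζ; norm_num at hζ
    · rcases mul_eq_zero.mp h'' with h3' | h3'
      · have hζm1 : ζ = -1 :=
          congrArg (fun e : W.xDivisionField 3 => (e : AlgebraicClosure K)) (eq_neg_of_add_eq_zero_left h3')
        rw [hζm1] at hζ; norm_num at hζ
      · exact hδ'0 h3'
  have hζ21' : ζ' ^ 2 * δ' ≠ ζ' * δ' := by
    intro h'
    have : ζ' * ((ζ' - 1) * δ') = 0 := by linear_combination h'
    rcases mul_eq_zero.mp this with h'' | h''
    · have : ζ = 0 := congrArg (fun e : W.xDivisionField 3 => (e : AlgebraicClosure K)) h''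
      rw [this] at hζ; norm_num at hζ
    · rcases mul_eq_zero.mp h'' with h3' | h3'
      · have hζ1 : ζ = 1 := congrArg (fun e : W.xDivisionField 3 => (e : AlgebraicClosure K)) (sub_eq_zero.mp h3')
        rw [hζ1] at hζ; norm_num at hζ
      · exact hδ'0 h3'
  let idx : (W.xDivisionField 3 ≃ₐ[K] W.xDivisionField 3) → Fin 3 := fun g =>
    if g δ' = δ' then 0 else if g δ' = ζ' * δ' then 1 else 2
  have hidx : ∀ g, g ∈ Q0 → (idx g = 0 ∧ g δ' = δ') ∨ (idx g = 1 ∧ g δ' = ζ' * δ') ∨ (idx g = 2 ∧ g δ' = ζ' ^ 2 * δ') := by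
    intro g hg
    rcases htri g hg with h | h | h
    · refine Or.inl ⟨?_, h⟩
      simp only [idx]
      rw [if_pos h]
    · refine Or.inr (Or.inl ⟨?_, h⟩)
      have hne : ¬ g δ' = δ' := by rw [h]; exact hζ1'
      simp only [idx]
      rw [if_neg hne, if_pos h]
    · refine Or.inr (Or.inr ⟨?_, h⟩)
      have hne : ¬ g δ' = δ' := by rw [h]; exact hζ2'
      have hne2 : ¬ g δ' = ζ' * δ' := by rw [h]; exact hζ21'
      simp only [idx]
      rw [if_neg hne, if_neg hne2]
  let Rof : Fin 3 → W.xDivisionField 3 := fun i => if i = 0 then R₀' else if i = 1 then R₁' else R₂'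
  have hRof0 : Rof 0 = R₀' := by simp [Rof]
  have hRof1 : Rof 1 = R₁' := by simp [Rof]
  have hRof2 : Rof 2 = R₂' := by simp [Rof]
  have hc4fix : ∀ g : W.xDivisionField 3 ≃ₐ[K] W.xDivisionField 3,
      g (algebraMap K (W.xDivisionField 3) W.c₄) = algebraMap K (W.xDivisionField 3) W.c₄ := fun g => g.commutes _
  have hsq0 : ∀ g, g ∈ Q0 → (g R₀') ^ 2 = (Rof (idx g)) ^ 2 := by
    intro g hg
    have e : (g R₀') ^ 2 = algebraMap K (W.xDivisionField 3) W.c₄ - 12 * g δ' := by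
      rw [← map_pow, h₀', map_sub, map_mul, hc4fix, map_ofNat]
    rcases hidx g hg with ⟨hi, hgδ⟩ | ⟨hi, hgδ⟩ | ⟨hi, hgδ⟩
    · rw [hi, hRof0, e, hgδ, h₀']
    · rw [hi, hRof1, e, hgδ, h₁']; ring
    · rw [hi, hRof2, e, hgδ, h₂']; ring
  have hsq1 : ∀ g, g ∈ Q0 → (g R₁') ^ 2 = (Rof (idx g + 1)) ^ 2 := by
    intro g hg
    have e : (g R₁') ^ 2 = algebraMap K (W.xDivisionField 3) W.c₄ - 12 * ζ' * g δ' := by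
      rw [← map_pow, h₁', map_sub, map_mul, map_mul, hc4fix, hgζ g hg, map_ofNat]
    rcases hidx g hg with ⟨hi, hgδ⟩ | ⟨hi, hgδ⟩ | ⟨hi, hgδ⟩
    · rw [hi, show (0 : Fin 3) + 1 = 1 from rfl, hRof1, e, hgδ, h₁']
    · rw [hi, show (1 : Fin 3) + 1 = 2 from rfl, hRof2, e, hgδ, h₂']; ring
    · rw [hi, show (2 : Fin 3) + 1 = 0 from rfl, hRof0, e, hgδ, h₀']
      linear_combination (-12 * δ') * hζ'3
  -- the injective map
  let f : Q0 → Fin 3 × Bool × Bool := fun g =>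
    (idx g, decide ((g : W.xDivisionField 3 ≃ₐ[K] W.xDivisionField 3) R₀' = Rof (idx g)),
      decide ((g : W.xDivisionField 3 ≃ₐ[K] W.xDivisionField 3) R₁' = Rof (idx g + 1)))
  have hf_inj : Function.Injective f := by
    rintro ⟨g, hg⟩ ⟨g', hg'⟩ hgg'
    simp only [f, Prod.mk.injEq, decide_eq_decide] at hgg'
    obtain ⟨ei, e0, e1⟩ := hgg'
    obtain ⟨σ, hσ⟩ := absRestrictNormalHom_surjective' (W.xDivisionField 3) g
    obtain ⟨σ', hσ'⟩ := absRestrictNormalHom_surjective' (W.xDivisionField 3) g'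
    have s0 := sq_eq_sq_iff_eq_or_eq_neg.mp (hsq0 g hg)
    have s0' := sq_eq_sq_iff_eq_or_eq_neg.mp (hsq0 g' hg')
    have s1 := sq_eq_sq_iff_eq_or_eq_neg.mp (hsq1 g hg)
    have s1' := sq_eq_sq_iff_eq_or_eq_neg.mp (hsq1 g' hg')
    rw [← ei] at s0' s1' e0 e1
    have a0 : g R₀' = g' R₀' := by
      rcases s0 with h | h
      · rw [h, e0.mp h]
      · rcases s0' with h' | h'
        · rw [h', e0.mpr h']
        · rw [h, h']
    have a1 : g R₁' = g' R₁' := by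
      rcases s1 with h | h
      · rw [h, e1.mp h]
      · rcases s1' with h' | h'
        · rw [h', e1.mpr h']
        · rw [h, h']
    have a0' : σ • R₀ = σ' • R₀ := by
      rw [← hresf g σ hσ R₀', ← hresf g' σ' hσ' R₀', a0]
    have a1' : σ • R₁ = σ' • R₁ := by
      rw [← hresf g σ hσ R₁', ← hresf g' σ' hσ' R₁', a1]
    exact Subtype.ext (W.algEquiv_xDivisionField_three_eq_of_smul_radical_eq hζ hδ h₀ h₁ h₂ hρ hc₆ hσ hσ' a0' a1')
  have hle12 : Nat.card Q0 ≤ 12 := by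
    have h := Nat.card_le_card_of_injective f hf_inj
    rwa [Nat.card_prod, Nat.card_prod, show Nat.card Bool = 2 by simp, show Nat.card (Fin 3) = 3 by simp] at h
  have hpos : 0 < Nat.card Q0 := Nat.card_pos
  exact le_antisymm hle12 (Nat.le_of_dvd hpos h12dvd)

end WeierstrassCurve

end
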